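import Mathlib.NumberTheory.NumberField.Cyclotomic.Basic
import Mathlib.RingTheory.PowerSeries.Evaluation
import Mathlib.Analysis.SpecificLimits.Normed
import Mathlib.NumberTheory.Padics.Complex
import Mathlib.Analysis.SpecificLimits.Basic
import Literature.NumberTheory.EllipticCurves.SelmerPInftyRelModelAction
import Literature.NumberTheory.GaloisRepresentations.LubinTateTorsion
import Literature.NumberTheory.EllipticCurves.FormalGroupLaurentPoints
import Literature.NumberTheory.EllipticCurves.FormalGroupKummerPointProofs
import HarnessLib
/-!
# Honda systems at supersingular primes (Sprung 2012 Thm. 2.2 / Kobayashi 2003 §8), I: evaluation of `p`-adic power series on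
# balls, points of the formal group of a `p`-adic model in the open unit ball (chart, addition, group structure), Fubini for ball
# series, formal-group sequences in `p`-adic closures, and the formal logarithm on the ball (Silverman AEC IV, VII; Cassels–Fröhlich)

**`p`-adic analytic groundwork for the Honda systems of F. Sprung, J. Number Theory 132 (2012) Thm. 2.2 [Sprung2012] and
S. Kobayashi, Invent. Math. 152 (2003) §8 [Kobayashi2003]** — the formal group of an elliptic curve over a complete `p`-adic field
(J. Silverman, *The Arithmetic of Elliptic Curves* (2009) IV §§1–6, VII §2 [SilvermanAEC2009]; Cassels–Fröhlich ch. VI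
[CasselsFrohlichANT1967]): evaluation of power series on the open unit ball, ball points of the formal group with their chart and
addition law, the logarithm.
RE-HOMED into `Literature/` by the Hodge foundations lane (`lit-hodgefound`, seat p20, generation 41): verbatim DECLARATION-LEVEL
ports, in dependency order, of the declarations of the modules `Summits/BirchSwinnertonDyer/{Rank1Residual/Additive, BirchSwinnertonDyer/Theorems}/ChiEigenPrimeToPDescentGenerator, PadicBallSeriesEval, FormalGroupBallPoints, FormalGroupBallPointsAdd, FormalGroupBallPointsAddII,
PadicBallFubini, PadicClosureFormalGroupSeq, PadicBallLog.lean`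
(BSD cells `b2b-bsdres` / `bsd-inputs`, where they certify `p`-adic analysis of formal groups and of the cyclotomic tower at a
supersingular prime — unconditional facts about elliptic curves over `ℚ` and `ℚ_p`, independent of the Birch–Swinnerton-Dyer conjecture),
namespaces `Summit.BirchSwinnertonDyer.Rank1Residual.Additive` and `Summit.BirchSwinnertonDyer.BirchSwinnertonDyer.Theorems` BOTH
re-rooted as `Literature.NumberTheory.EllipticCurves.Sprung2012.Honda` (sub-namespaces `BallEval`, `PadicCyclotomicTower`, `HondaFss`,
`SprungHonda`, `SignedEC`, … kept).  The declarations of the cone that are already in `Literature/` (Kobayashi's signed local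
conditions `localFixedPointsOfEmb`, `localPairTraceOfEmb`, `towerSubgroup`, … of
`NumberTheory/EllipticCurves/Kobayashi2003/CyclotomicTowerSignedSelmer.lean`) are IMPORTED, not duplicated.  Definitions are ported with
their bodies (real `def`s: evaluation maps, ball points, logarithms, towers, transported points — no `Prop`-valued placeholder, no
named fact: D-0026 net debt 0 for this file); every declaration carries the citation of the printed step it formalises or serves;
imports Mathlib/Literature only.  The Summits originals stay in place (transitional duplication; twins = same short names under the two
Summits namespaces).  Nothing here bears on the Birch–Swinnerton-Dyer conjecture or any summit statement.
Consumed by `HondaSystemCyclotomicTowerPoints.lean` … `HondaSystemExistsHolds.lean` (same directory).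
-/

noncomputable section

/-!
## Part 1 — port of `Summits/BirchSwinnertonDyer/Rank1Residual/Additive/ChiEigenPrimeToPDescentGenerator.lean` (2 declarations kept)

# Generator normalisation into `Gal(ℚ̄/K·F)` for the `F`-level eigen datum, the cyclotomic case
# `F = ℚ(ζ_p)`, and the end-to-end packaging

(Port of the declarations listed in the Part header; the source module's docstring — cell bookkeeping of the BSD
printed-inputs programme — is abridged to its title here.)
-/

section Part1

open scoped _root_.Classical

namespace Literature.NumberTheory.EllipticCurves.Sprung2012.Honda

open Literature.NumberTheory.EllipticCurves Literature.NumberTheory.GaloisRepresentations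
  _root_.WeierstrassCurve

/-! ## §0 A subgroup of `ℤ_p` of finite index prime to `p` is everything -/

section Zp

variable {p : ℕ} [Fact p.Prime]

end Zp

/-! ## §5 Generator normalisation at `F`-level -/

section Gen

variable (K : Type) [Field K] [NumberField K] (h2 : Module.finrank ℚ K = 2) {θ : K} {c : ℚ}
  (hθ : θ ∉ Set.range (algebraMap ℚ K)) (hc : θ ^ 2 = algebraMap ℚ K c) {p : ℕ} [Fact p.Prime]
  (κ : ZpExtension ℚ p) (U : Subgroup (Field.absoluteGaloisGroup ℚ)) [U.Normal]
  (hcop : U.index.Coprime p)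

variable (V : WeierstrassCurve ℚ) [(galRange (K := ℚ) K).Normal]

end Gen

/-! ## §5b End to end: every `Λ`-dual datum of `Sel_{p^∞}(E/ℚ_∞)` is an `F`-level eigen datum at a
generator INSIDE `Gal(ℚ̄/K) ⊓ U`, with the same characteristic ideal -/

section EndToEnd

variable (V : WeierstrassCurve ℚ) (K : Type) [Field K] [NumberField K]
  (h2 : Module.finrank ℚ K = 2) {θ : K} {c : ℚ} (hθ : θ ∉ Set.range (algebraMap ℚ K))
  (hc : θ ^ 2 = algebraMap ℚ K c) (p : ℕ) [Fact p.Prime] (κ : ZpExtension ℚ p)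
  [(galRange (K := ℚ) K).Normal] [(V.quadraticTwist c).IsElliptic] [V.IsElliptic]
  {W : WeierstrassCurve ℚ} {C : VariableChange ℚ} (hCW : C • V.quadraticTwist c = W)
  (U : Subgroup (Field.absoluteGaloisGroup ℚ)) [U.Normal]
  (hU : IsOpen (U : Set (Field.absoluteGaloisGroup ℚ))) (hcop : U.index.Coprime p) (hp2 : p ≠ 2)

end EndToEnd

/-! ## §6 The cyclotomic case `U = Gal(ℚ̄/ℚ(ζ_p))`: index `p − 1`, prime to `p` -/

section Cyclotomic

variable (p : ℕ) [hp : Fact p.Prime] (F : Type) [Field F] [NumberField F]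
  [hF : IsCyclotomicExtension {p} ℚ F]

omit hp in
include hF in
/-- `galRange F` is normal in `Γ_ℚ` for `F = ℚ(ζ_p)` (Galois). [cite: Washington1997, §13.1] -/
theorem normal_galRange_cyclotomic : (galRange (K := ℚ) F).Normal := by
  haveI : IsGalois ℚ F := IsCyclotomicExtension.isGalois {p} ℚ F
  exact RelModel.normal_galRange F

/-- `[Γ_ℚ : galRange F] = [ℚ(ζ_p) : ℚ] = p − 1`. [cite: Washington1997, §13.1] -/
theorem index_galRange_cyclotomic : (galRange (K := ℚ) F).index = p - 1 := by
  haveI : IsGalois ℚ F := IsCyclotomicExtension.isGalois {p} ℚ F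
  rw [RelModel.index_galRange F,
    IsCyclotomicExtension.finrank F (Polynomial.cyclotomic.irreducible_rat hp.out.pos),
    Nat.totient_prime hp.out]

variable (V : WeierstrassCurve ℚ) (K : Type) [Field K] [NumberField K]
  (h2 : Module.finrank ℚ K = 2) {θ : K} {c : ℚ} (hθ : θ ∉ Set.range (algebraMap ℚ K))
  (hc : θ ^ 2 = algebraMap ℚ K c) (κ : ZpExtension ℚ p)
  [(galRange (K := ℚ) K).Normal] [(V.quadraticTwist c).IsElliptic] [V.IsElliptic]
  {W : WeierstrassCurve ℚ} {C : VariableChange ℚ} (hCW : C • V.quadraticTwist c = W) (hp2 : p ≠ 2)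

end Cyclotomic

end Literature.NumberTheory.EllipticCurves.Sprung2012.Honda

end Part1

/-!
## Part 2 — port of `Summits/BirchSwinnertonDyer/Rank1Residual/Additive/PadicBallSeriesEval.lean` (22 declarations kept)

# Evaluation of `ℤ_p`-power series (one and two variables) at points of the open unit disc of a
# COMPLETE ultrametric normed `ℚ_p`-algebra `K`, with values in `𝒪_K` — ring homomorphism,
# compatibility with substitution, the sum formula, and the basic bounds

(Port of the declarations listed in the Part header; the source module's docstring — cell bookkeeping of the BSD
printed-inputs programme — is abridged to its title here.)
-/

section Part2

open scoped _root_.Classical _root_.Topology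
open _root_.Filter MvPowerSeries _root_.PowerSeries MvPowerSeries.WithPiTopology PowerSeries.WithPiTopology

namespace Literature.NumberTheory.EllipticCurves.Sprung2012.Honda

namespace BallEval

open Literature.NumberTheory.GaloisRepresentations.LubinTate (unitBall mem_unitBall_iff
  isTopologicallyNilpotent_of_norm_lt_one)
open Literature.NumberTheory.EllipticCurves (mvPowerSeries_continuous_subst)

variable (p : ℕ) [hp : Fact p.Prime] (K : Type*) [NontriviallyNormedField K] [NormedAlgebra ℚ_[p] K]
  [IsUltrametricDist K] [CompleteSpace K]

/-! ## §1 The coefficient map `ℤ_p → 𝒪_K` and evaluable points -/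

omit [IsUltrametricDist K] [CompleteSpace K] in
/-- `‖q‖_K = ‖q‖_p` for `q ∈ ℚ_p` mapped into the normed `ℚ_p`-algebra `K`. [cite: SilvermanAEC2009, IV.1] -/
theorem norm_algebraMap_padic (q : ℚ_[p]) : ‖algebraMap ℚ_[p] K q‖ = ‖q‖ :=
  norm_algebraMap' K q

/-- **The coefficient map `ℤ_p → 𝒪_K`** (`ℤ_p ⊂ ℚ_p → K` lands in the closed unit ball).
[cite: CasselsFrohlichANT1967, Ch. VI §3.2] -/
def coeffHom : ℤ_[p] →+* unitBall K :=
  ((algebraMap ℚ_[p] K).comp (PadicInt.Coe.ringHom (p := p))).codRestrict (unitBall K) fun x => by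
    rw [mem_unitBall_iff]
    change ‖algebraMap ℚ_[p] K (x : ℚ_[p])‖ ≤ 1
    rw [norm_algebraMap_padic]
    exact PadicInt.norm_le_one x

omit [CompleteSpace K] in
/-- The coefficient map on underlying elements: `(coeffHom x : K) = algebraMap ℚ_p K x`. [cite: SilvermanAEC2009, IV.1] -/
@[simp] theorem coe_coeffHom (x : ℤ_[p]) :
    ((coeffHom p K x : unitBall K) : K) = algebraMap ℚ_[p] K (x : ℚ_[p]) := rfl

omit [CompleteSpace K] in
/-- The coefficient map is continuous. [cite: SilvermanAEC2009, IV.1] -/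
theorem continuous_coeffHom : Continuous (coeffHom p K : ℤ_[p] → unitBall K) := by
  refine Continuous.subtype_mk ?_ _
  exact (continuous_algebraMap ℚ_[p] K).comp continuous_subtype_val

variable {p K}

omit [NormedAlgebra ℚ_[p] K] [CompleteSpace K] hp in
/-- A point of the open unit disc is evaluable (topologically nilpotent in `𝒪_K`). [cite: SilvermanAEC2009, IV.1] -/
theorem hasEval_of_norm_lt_one {t : unitBall K} (ht : ‖(t : K)‖ < 1) : PowerSeries.HasEval t :=
  (PowerSeries.hasEval_def t).mpr (isTopologicallyNilpotent_of_norm_lt_one K ht)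

omit [NormedAlgebra ℚ_[p] K] [CompleteSpace K] hp in
/-- Finite families of points of the open unit disc are evaluable. [cite: SilvermanAEC2009, IV.1] -/
theorem mvHasEval_of_norm_lt_one {τ : Type*} [Finite τ] {b : τ → unitBall K}
    (hb : ∀ i, ‖(b i : K)‖ < 1) : MvPowerSeries.HasEval b where
  hpow i := isTopologicallyNilpotent_of_norm_lt_one K (hb i)
  tendsto_zero := by
    rw [(Filter.cofinite_eq_bot_iff.mpr ‹Finite τ›)]
    exact tendsto_bot

omit [NormedAlgebra ℚ_[p] K] [CompleteSpace K] hp in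
/-- The pair `(u, v)` as an evaluable family on `Fin 2`. [cite: SilvermanAEC2009, IV.1] -/
theorem hasEval_pair {u v : unitBall K} (hu : ‖(u : K)‖ < 1) (hv : ‖(v : K)‖ < 1) :
    MvPowerSeries.HasEval ![u, v] :=
  mvHasEval_of_norm_lt_one fun i => by fin_cases i <;> assumption

/-! ## §2 The evaluation homomorphisms and substitution -/

variable (p K)

/-- **Evaluation of `ℤ_p`-series in several variables at an evaluable family `b`**, as a ring
homomorphism `MvPowerSeries τ ℤ_[p] →+* 𝒪_K` (Mathlib `MvPowerSeries.eval₂Hom` for the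
continuous coefficient map `ℤ_p → 𝒪_K`). [cite: CasselsFrohlichANT1967, Ch. VI §3.2] -/
def ev {τ : Type*} (b : τ → unitBall K) (hb : MvPowerSeries.HasEval b) :
    MvPowerSeries τ ℤ_[p] →+* unitBall K :=
  MvPowerSeries.eval₂Hom (continuous_coeffHom p K) hb

/-- **Evaluation of one-variable `ℤ_p`-series at an evaluable point `t`** (`PowerSeries.eval₂Hom`).
[cite: SilvermanAEC2009, IV.1] -/
def ev₁ (t : unitBall K) (ht : PowerSeries.HasEval t) : ℤ_[p]⟦X⟧ →+* unitBall K :=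
  PowerSeries.eval₂Hom (continuous_coeffHom p K) ht

variable {p K}

/-- `ev` is Mathlib's `eval₂`. [cite: SilvermanAEC2009, IV.1] -/
theorem ev_apply {τ : Type*} {b : τ → unitBall K} (hb : MvPowerSeries.HasEval b)
    (f : MvPowerSeries τ ℤ_[p]) : ev p K b hb f = MvPowerSeries.eval₂ (coeffHom p K) b f := by
  rw [ev, MvPowerSeries.coe_eval₂Hom]

/-- `ev₁` is Mathlib's `PowerSeries.eval₂`. [cite: SilvermanAEC2009, IV.1] -/
theorem ev₁_apply {t : unitBall K} (ht : PowerSeries.HasEval t) (f : ℤ_[p]⟦X⟧) :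
    ev₁ p K t ht f = PowerSeries.eval₂ (coeffHom p K) t f := by
  rw [ev₁, PowerSeries.coe_eval₂Hom]

/-- `ev (X s) = b s`. [cite: SilvermanAEC2009, IV.1] -/
@[simp] theorem ev_X {τ : Type*} {b : τ → unitBall K} (hb : MvPowerSeries.HasEval b) (s : τ) :
    ev p K b hb (MvPowerSeries.X s) = b s := by
  rw [ev_apply, MvPowerSeries.eval₂_X]

/-- `ev (C r) = φ r`. [cite: SilvermanAEC2009, IV.1] -/
@[simp] theorem ev_C {τ : Type*} {b : τ → unitBall K} (hb : MvPowerSeries.HasEval b) (r : ℤ_[p]) :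
    ev p K b hb (MvPowerSeries.C r) = coeffHom p K r := by
  rw [ev_apply, MvPowerSeries.eval₂_C]

/-- `ev₁ X = t`. [cite: SilvermanAEC2009, IV.1] -/
@[simp] theorem ev₁_X {t : unitBall K} (ht : PowerSeries.HasEval t) :
    ev₁ p K t ht PowerSeries.X = t := by
  rw [ev₁_apply, PowerSeries.eval₂_X]

/-- `ev₁ (C r) = φ r`. [cite: SilvermanAEC2009, IV.1] -/
@[simp] theorem ev₁_C {t : unitBall K} (ht : PowerSeries.HasEval t) (r : ℤ_[p]) :
    ev₁ p K t ht (PowerSeries.C r) = coeffHom p K r := by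
  rw [ev₁_apply, PowerSeries.eval₂_C]

/-- **Evaluation commutes with substitution** (several variables): `(subst a f)(b) = f(a(b))`.
Both sides are continuous in `f` (substitution is continuous for any coefficient topology — the
tree's `mvPowerSeries_continuous_subst`) and agree on polynomials (Mathlib `eval₂_unique`).
[Bourbaki, Algèbre IV §4 no. 3, Prop. 4] [cite: SilvermanAEC2009, IV.1] -/
theorem ev_subst {σ τ : Type*} {a : σ → MvPowerSeries τ ℤ_[p]} (ha : MvPowerSeries.HasSubst a)
    {b : τ → unitBall K} (hb : MvPowerSeries.HasEval b) (f : MvPowerSeries σ ℤ_[p]) :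
    ev p K b hb (MvPowerSeries.subst a f) =
      MvPowerSeries.eval₂ (coeffHom p K) (fun s => ev p K b hb (a s)) f := by
  have hφ := continuous_coeffHom p K
  have hc : Continuous (ev p K b hb) := by
    change Continuous (MvPowerSeries.eval₂Hom hφ hb)
    rw [MvPowerSeries.coe_eval₂Hom]
    exact MvPowerSeries.continuous_eval₂ hφ hb
  have hb' : MvPowerSeries.HasEval fun s => ev p K b hb (a s) :=
    (ha.hasEval (S := ℤ_[p])).map hc
  have key := MvPowerSeries.eval₂_unique hφ hb'
    (ε := fun f => ev p K b hb (MvPowerSeries.subst a f))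
    (hc.comp (mvPowerSeries_continuous_subst ha)) ?_
  · exact congr_fun key f
  · intro q
    rw [MvPowerSeries.subst_coe]
    induction q using MvPolynomial.induction_on with
    | C r =>
      rw [MvPolynomial.aeval_C, MvPolynomial.eval₂_C, MvPowerSeries.algebraMap_apply,
        Algebra.algebraMap_self, RingHom.id_apply, ev_C]
    | add f g hf hg => rw [map_add, MvPolynomial.eval₂_add, map_add, hf, hg]
    | mul_X f s hf =>
      rw [map_mul, MvPolynomial.aeval_X, MvPolynomial.eval₂_mul, MvPolynomial.eval₂_X, map_mul, hf]

/-- The one-variable-into-several case: `(f.subst a)(b) = f(a(b))` for `f ∈ ℤ_p⟦X⟧`. [cite: SilvermanAEC2009, IV.1] -/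
theorem ev_powerSeries_subst {τ : Type*} {a : MvPowerSeries τ ℤ_[p]} (ha : PowerSeries.HasSubst a)
    {b : τ → unitBall K} (hb : MvPowerSeries.HasEval b) (f : ℤ_[p]⟦X⟧) :
    ev p K b hb (f.subst a) = PowerSeries.eval₂ (coeffHom p K) (ev p K b hb a) f :=
  ev_subst (PowerSeries.HasSubst.const ha) hb f

/-- One variable into one variable: `(f ∘ g)(t) = f(g(t))` for `g(0) = 0`. [cite: SilvermanAEC2009, IV.1] -/
theorem ev₁_subst {g : ℤ_[p]⟦X⟧} (hg : PowerSeries.constantCoeff g = 0) {t : unitBall K}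
    (ht : PowerSeries.HasEval t) (hgt : PowerSeries.HasEval (ev₁ p K t ht g)) (f : ℤ_[p]⟦X⟧) :
    ev₁ p K t ht (f.subst g) = ev₁ p K (ev₁ p K t ht g) hgt f := by
  have ha : PowerSeries.HasSubst g := PowerSeries.HasSubst.of_constantCoeff_zero' hg
  have hb : MvPowerSeries.HasEval (fun _ : Unit => t) := by
    refine ⟨fun _ => (PowerSeries.hasEval_def t).mp ht, ?_⟩
    rw [(Filter.cofinite_eq_bot_iff.mpr inferInstance)]; exact tendsto_bot
  have h := ev_subst (K := K) (PowerSeries.HasSubst.const ha) hb f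
  have e1 : ev p K (fun _ : Unit => t) hb = ev₁ p K t ht := by
    ext x : 1
    rw [ev_apply, ev₁_apply]; rfl
  rw [e1] at h
  rw [show f.subst g = MvPowerSeries.subst (fun _ : Unit => g) f from rfl, h, ev₁_apply (ht := hgt)]
  rfl

/-! ## §3 Values in `K`: the sum formula and bounds -/

/-- **The sum formula**: `ev₁ f t = ∑ₙ φ(fₙ) tⁿ` in `K`. [cite: SilvermanAEC2009, IV.1] -/
theorem hasSum_ev₁ {t : unitBall K} (ht : PowerSeries.HasEval t) (f : ℤ_[p]⟦X⟧) :
    HasSum (fun n : ℕ => algebraMap ℚ_[p] K ((PowerSeries.coeff n f : ℤ_[p]) : ℚ_[p]) * (t : K) ^ n)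
      ((ev₁ p K t ht f : unitBall K) : K) := by
  have h := (PowerSeries.hasSum_eval₂ (continuous_coeffHom p K) ht f).map (unitBall K).subtype
    continuous_subtype_val
  have e : (fun n : ℕ => algebraMap ℚ_[p] K ((PowerSeries.coeff n f : ℤ_[p]) : ℚ_[p]) * (t : K) ^ n) =
      (unitBall K).subtype ∘ fun n : ℕ => coeffHom p K (PowerSeries.coeff n f) * t ^ n := by
    funext n
    simp only [Function.comp_apply, Subring.coe_subtype, Subring.coe_mul, SubmonoidClass.coe_pow,
      coe_coeffHom]
  rw [ev₁_apply, e]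
  exact h

/-- **`‖f(t)‖ ≤ ‖t‖` when `f(0) = 0`** (every term `φ(fₙ)tⁿ`, `n ≥ 1`, has norm `≤ ‖t‖`).
[cite: SilvermanAEC2009, IV.1] -/
theorem norm_ev₁_le {t : unitBall K} (ht : PowerSeries.HasEval t) (ht1 : ‖(t : K)‖ ≤ 1)
    {f : ℤ_[p]⟦X⟧} (hf0 : PowerSeries.constantCoeff f = 0) :
    ‖((ev₁ p K t ht f : unitBall K) : K)‖ ≤ ‖(t : K)‖ := by
  rw [← (hasSum_ev₁ ht f).tsum_eq]
  refine IsUltrametricDist.norm_tsum_le_of_forall_le_of_nonneg (norm_nonneg _) fun n => ?_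
  rcases Nat.eq_zero_or_pos n with rfl | hn
  · rw [PowerSeries.coeff_zero_eq_constantCoeff, hf0]; simp
  · rw [norm_mul, norm_pow, norm_algebraMap_padic]
    calc ‖((PowerSeries.coeff n f : ℤ_[p]) : ℚ_[p])‖ * ‖(t : K)‖ ^ n ≤ 1 * ‖(t : K)‖ ^ 1 := by
          refine mul_le_mul (PadicInt.norm_le_one _) ?_ (pow_nonneg (norm_nonneg _) _) zero_le_one
          exact pow_le_pow_of_le_one (norm_nonneg _) ht1 hn
      _ = ‖(t : K)‖ := by rw [one_mul, pow_one]

/-- **The sum formula, several variables**: `ev F b = ∑_d φ(F_d) ∏ (b s)^{d s}` in `K`. [cite: SilvermanAEC2009, IV.1] -/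
theorem hasSum_ev {τ : Type*} {b : τ → unitBall K} (hb : MvPowerSeries.HasEval b)
    (F : MvPowerSeries τ ℤ_[p]) :
    HasSum (fun d : τ →₀ ℕ => algebraMap ℚ_[p] K ((MvPowerSeries.coeff d F : ℤ_[p]) : ℚ_[p]) *
        d.prod fun s e => ((b s : unitBall K) : K) ^ e)
      ((ev p K b hb F : unitBall K) : K) := by
  have h := (MvPowerSeries.hasSum_eval₂ (continuous_coeffHom p K) hb F).map (unitBall K).subtype
    continuous_subtype_val
  have e : (fun d : τ →₀ ℕ => algebraMap ℚ_[p] K ((MvPowerSeries.coeff d F : ℤ_[p]) : ℚ_[p]) *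
        d.prod fun s e => ((b s : unitBall K) : K) ^ e) =
      (unitBall K).subtype ∘ fun d : τ →₀ ℕ =>
        coeffHom p K (MvPowerSeries.coeff d F) * d.prod fun s e => b s ^ e := by
    funext d
    simp only [Function.comp_apply, Subring.coe_subtype, Subring.coe_mul, coe_coeffHom, Finsupp.prod,
      SubmonoidClass.coe_finsetProd, SubmonoidClass.coe_pow]
  rw [ev_apply, e]
  exact h

/-- **`‖F(b)‖ ≤ max ‖b s‖` when `F(0) = 0`** (finite index type, all `‖b s‖ ≤ 1`): every term of
the sum formula with `d ≠ 0` contains a factor `b s`. [cite: SilvermanAEC2009, IV.1] -/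
theorem norm_ev_le_of_constantCoeff_eq_zero {τ : Type*} [Fintype τ] [Nonempty τ]
    {b : τ → unitBall K} (hb : MvPowerSeries.HasEval b) {F : MvPowerSeries τ ℤ_[p]}
    (hF0 : MvPowerSeries.constantCoeff F = 0) :
    ‖((ev p K b hb F : unitBall K) : K)‖ ≤ Finset.univ.sup' Finset.univ_nonempty fun s => ‖(b s : K)‖ := by
  set r := Finset.univ.sup' Finset.univ_nonempty fun s => ‖(b s : K)‖ with hr
  have hr0 : 0 ≤ r := by
    obtain ⟨s⟩ := ‹Nonempty τ›
    exact (norm_nonneg _).trans (Finset.le_sup' (fun s => ‖(b s : K)‖) (Finset.mem_univ s))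
  have hbs : ∀ s, ‖(b s : K)‖ ≤ r := fun s => Finset.le_sup' (fun s => ‖(b s : K)‖) (Finset.mem_univ s)
  have hb1 : ∀ s, ‖(b s : K)‖ ≤ 1 := fun s => (mem_unitBall_iff K).mp (b s).2
  rw [← (hasSum_ev hb F).tsum_eq]
  refine IsUltrametricDist.norm_tsum_le_of_forall_le_of_nonneg hr0 fun d => ?_
  by_cases hd : d = 0
  · subst hd
    rw [MvPowerSeries.coeff_zero_eq_constantCoeff, hF0]; simp [hr0]
  · obtain ⟨s, hs⟩ := Finsupp.ne_iff.mp hd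
    rw [norm_mul, norm_algebraMap_padic]
    have hprod : ‖d.prod fun s e => ((b s : unitBall K) : K) ^ e‖ ≤ r := by
      rw [Finsupp.prod, ← Finset.prod_erase_mul _ _ (Finsupp.mem_support_iff.mpr hs), norm_mul]
      have h1 : ‖∏ x ∈ d.support.erase s, ((b x : unitBall K) : K) ^ d x‖ ≤ 1 := by
        rw [norm_prod]
        exact Finset.prod_le_one (fun _ _ => norm_nonneg _) fun x _ => by
          rw [norm_pow]; exact pow_le_one₀ (norm_nonneg _) (hb1 x)
      have h2 : ‖((b s : unitBall K) : K) ^ d s‖ ≤ r := by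
        rw [norm_pow]
        simp only [Finsupp.coe_zero, Pi.zero_apply, ne_eq] at hs
        calc ‖(b s : K)‖ ^ d s ≤ ‖(b s : K)‖ ^ 1 :=
              pow_le_pow_of_le_one (norm_nonneg _) (hb1 s) (Nat.pos_of_ne_zero hs)
          _ ≤ r := by rw [pow_one]; exact hbs s
      calc _ ≤ 1 * r := mul_le_mul h1 h2 (norm_nonneg _) zero_le_one
        _ = r := one_mul r
    calc _ ≤ 1 * r := mul_le_mul (PadicInt.norm_le_one _) hprod (norm_nonneg _) zero_le_one
      _ = r := one_mul r

end BallEval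

end Literature.NumberTheory.EllipticCurves.Sprung2012.Honda

end Part2

/-!
## Part 3 — port of `Summits/BirchSwinnertonDyer/Rank1Residual/Additive/FormalGroupBallPoints.lean` (26 declarations kept)

# The formal point with prescribed parameter over a complete ultrametric normed `ℚ_p`-algebra:
# `P(t) = (X(t)/t², −X(t)/t³) ∈ E₁(K)`, `z(P(t)) = t`, every `P ∈ E₁(K)` is `P(z(P))`, and
# `−P(t) = P(i(t))`

(Port of the declarations listed in the Part header; the source module's docstring — cell bookkeeping of the BSD
printed-inputs programme — is abridged to its title here.)
-/

section Part3

open scoped _root_.Classical _root_.Topology _root_.NNReal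
open _root_.Filter _root_.PowerSeries

namespace Literature.NumberTheory.EllipticCurves.Sprung2012.Honda

namespace BallEval

open Literature.NumberTheory.GaloisRepresentations.LubinTate (unitBall mem_unitBall_iff)
open Literature.NumberTheory.EllipticCurves Literature.NumberTheory.EllipticCurves.FormalGroupChart
open _root_.WeierstrassCurve

variable (p : ℕ) [hp : Fact p.Prime] (K : Type*) [NontriviallyNormedField K] [NormedAlgebra ℚ_[p] K]
  [IsUltrametricDist K] [CompleteSpace K] (M : WeierstrassCurve ℤ_[p])

/-! ## §1 The curve over `K`, `X(t)`, and the equation in the chart -/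

/-- **`E = M ⊗ K`**, the base change of `M/ℤ_p` along `ℤ_p → 𝒪_K ⊂ K`. [cite: SilvermanAEC2009, IV.1] -/
def curveK : WeierstrassCurve K := M.map ((unitBall K).subtype.comp (coeffHom p K))

omit [CompleteSpace K] in
/-- `curveK` has `𝒪_K`-integral coefficients (a theorem; introduce with `haveI`). [cite: SilvermanAEC2009, IV.1] -/
theorem isIntegral_curveK : (curveK p K M).IsIntegral (NormedField.valuation (K := K)).integer :=
  ⟨⟨M.map (coeffHom p K), by rw [curveK, WeierstrassCurve.baseChange, WeierstrassCurve.map_map]; rfl⟩⟩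

omit [CompleteSpace K] in
/-- `curveK` is an elliptic curve when the generic fibre of `M` is. [cite: SilvermanAEC2009, IV.1] -/
theorem isElliptic_curveK [hE : (M.map PadicInt.Coe.ringHom).IsElliptic] : (curveK p K M).IsElliptic := by
  refine ⟨?_⟩
  have h : (curveK p K M).Δ = algebraMap ℚ_[p] K ((M.map PadicInt.Coe.ringHom).Δ) := by
    rw [curveK, WeierstrassCurve.map_Δ, WeierstrassCurve.map_Δ]; rfl
  rw [h, isUnit_iff_ne_zero, map_ne_zero_iff _ (algebraMap ℚ_[p] K).injective]
  exact (M.map PadicInt.Coe.ringHom).isUnit_Δ.ne_zero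

variable {K}

/-- **`X(t) = ev₁ t (z²x(z))`**, the value of `formalXMulSq` at a point of the open disc.
[cite: SilvermanAEC2009, IV.1] -/
def evX (t : unitBall K) (ht : ‖(t : K)‖ < 1) : K :=
  ((ev₁ p K t (hasEval_of_norm_lt_one ht) M.formalXMulSq : unitBall K) : K)

variable {p M}

/-- `‖X(t) − 1‖ ≤ ‖t‖ < 1` (`X = 1 + (terms divisible by z)`). [cite: SilvermanAEC2009, IV.1] -/
theorem norm_evX_sub_one_le {t : unitBall K} (ht : ‖(t : K)‖ < 1) : ‖evX p M t ht - 1‖ ≤ ‖(t : K)‖ := by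
  have ht1 : ‖(t : K)‖ ≤ 1 := ht.le
  have h0 : PowerSeries.constantCoeff (M.formalXMulSq - 1) = 0 := by
    rw [map_sub, M.constantCoeff_formalXMulSq, map_one, sub_self]
  have := norm_ev₁_le (hasEval_of_norm_lt_one ht) ht1 h0
  rwa [map_sub, map_one, AddSubgroupClass.coe_sub, OneMemClass.coe_one] at this

/-- **`‖X(t)‖ = 1`.** [cite: SilvermanAEC2009, IV.1] -/
theorem norm_evX {t : unitBall K} (ht : ‖(t : K)‖ < 1) : ‖evX p M t ht‖ = 1 := by
  have h := (norm_evX_sub_one_le (p := p) (M := M) ht).trans_lt ht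
  have e : evX p M t ht = 1 + (evX p M t ht - 1) := by ring
  rw [e, IsUltrametricDist.norm_add_eq_max_of_norm_ne_norm, norm_one, max_eq_left h.le]
  rw [norm_one]; exact (ne_of_lt h).symm

/-- `X(t) ≠ 0`. [cite: SilvermanAEC2009, IV.1] -/
theorem evX_ne_zero {t : unitBall K} (ht : ‖(t : K)‖ < 1) : evX p M t ht ≠ 0 := by
  rw [← norm_ne_zero_iff, norm_evX (p := p) (M := M) ht]; exact one_ne_zero

/-- **The Weierstrass equation in the chart at a point**: with `A = X(t)`, `s = t`,
`A² = A³ + a₁sA² + a₂s²A² + a₃s³A + a₄s⁴A + a₆s⁶` (the tree's `formalXMulSq_sq_eq` evaluated).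
[cite: SilvermanAEC2009, IV.1] -/
theorem equation_chart {t : unitBall K} (ht : ‖(t : K)‖ < 1) :
    evX p M t ht ^ 2 = evX p M t ht ^ 3 + (coeffHom p K M.a₁ : K) * (t : K) * evX p M t ht ^ 2 +
      (coeffHom p K M.a₂ : K) * (t : K) ^ 2 * evX p M t ht ^ 2 +
      (coeffHom p K M.a₃ : K) * (t : K) ^ 3 * evX p M t ht +
      (coeffHom p K M.a₄ : K) * (t : K) ^ 4 * evX p M t ht + (coeffHom p K M.a₆ : K) * (t : K) ^ 6 := by
  have h := congrArg (fun f => ((ev₁ p K t (hasEval_of_norm_lt_one ht) f : unitBall K) : K))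
    M.formalXMulSq_sq_eq
  simp only [map_add, map_mul, map_pow, ev₁_X, ev₁_C, Subring.coe_add, Subring.coe_mul,
    SubmonoidClass.coe_pow] at h
  exact h

variable (p K M) in
/-- The affine coordinates of the formal point satisfy the Weierstrass equation of `E`.
[cite: SilvermanAEC2009, IV.1] -/
theorem equation_ptOf {t : unitBall K} (ht : ‖(t : K)‖ < 1) (ht0 : (t : K) ≠ 0) :
    (curveK p K M).toAffine.Equation (evX p M t ht / (t : K) ^ 2) (-evX p M t ht / (t : K) ^ 3) := by
  have hid := equation_chart (p := p) (M := M) ht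
  have hs6 : (t : K) ^ 6 ≠ 0 := pow_ne_zero 6 ht0
  rw [Affine.equation_iff]
  simp only [curveK, map_a₁, map_a₂, map_a₃, map_a₄, map_a₆, RingHom.coe_comp, Function.comp_apply,
    Subring.coe_subtype]
  set A : K := evX p M t ht
  set s : K := (t : K)
  have e1 : (-A / s ^ 3) ^ 2 + (coeffHom p K M.a₁ : K) * (A / s ^ 2) * (-A / s ^ 3) +
      (coeffHom p K M.a₃ : K) * (-A / s ^ 3) =
      (A ^ 2 - (coeffHom p K M.a₁ : K) * s * A ^ 2 - (coeffHom p K M.a₃ : K) * s ^ 3 * A) / s ^ 6 := by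
    field_simp
    ring
  have e2 : (A / s ^ 2) ^ 3 + (coeffHom p K M.a₂ : K) * (A / s ^ 2) ^ 2 +
      (coeffHom p K M.a₄ : K) * (A / s ^ 2) + (coeffHom p K M.a₆ : K) =
      (A ^ 3 + (coeffHom p K M.a₂ : K) * s ^ 2 * A ^ 2 + (coeffHom p K M.a₄ : K) * s ^ 4 * A +
        (coeffHom p K M.a₆ : K) * s ^ 6) / s ^ 6 := by
    field_simp
  rw [e1, e2, div_left_inj' hs6]
  linear_combination hid

variable [hE : (M.map PadicInt.Coe.ringHom).IsElliptic]

variable (p K M) in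
/-- The formal point is nonsingular. [cite: SilvermanAEC2009, IV.1] -/
theorem nonsingular_ptOf {t : unitBall K} (ht : ‖(t : K)‖ < 1) (ht0 : (t : K) ≠ 0) :
    (curveK p K M).toAffine.Nonsingular (evX p M t ht / (t : K) ^ 2) (-evX p M t ht / (t : K) ^ 3) := by
  haveI := isElliptic_curveK p K M
  exact (Affine.equation_iff_nonsingular (W := curveK p K M)).mp (equation_ptOf p K M ht ht0)

/-! ## §2 The formal point `P(t)` and the dictionary -/

variable (p K M) in
/-- **The formal point `P(t) = (X(t)/t², −X(t)/t³) ∈ E(K)`** with parameter `t` (`P(0) = O`).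
[cite: SilvermanAEC2009, Prop. VII.2.2] -/
def ptOf (t : unitBall K) (ht : ‖(t : K)‖ < 1) : (curveK p K M).toAffine.Point :=
  if ht0 : (t : K) = 0 then 0 else .some _ _ (nonsingular_ptOf p K M ht ht0)

/-- `P(t) = O` when `t = 0`. [cite: SilvermanAEC2009, IV.1] -/
theorem ptOf_of_eq_zero {t : unitBall K} (ht : ‖(t : K)‖ < 1) (ht0 : (t : K) = 0) : ptOf p K M t ht = 0 := by
  rw [ptOf, dif_pos ht0]

/-- `P(t) = (X(t)/t², −X(t)/t³)` when `t ≠ 0`. [cite: SilvermanAEC2009, IV.1] -/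
theorem ptOf_of_ne_zero {t : unitBall K} (ht : ‖(t : K)‖ < 1) (ht0 : (t : K) ≠ 0) :
    ptOf p K M t ht = .some _ _ (nonsingular_ptOf p K M ht ht0) := by
  rw [ptOf, dif_neg ht0]

/-- `ptOf` depends only on the underlying element. [cite: SilvermanAEC2009, IV.1] -/
theorem ptOf_congr {t t' : unitBall K} (h : (t : K) = t') (ht : ‖(t : K)‖ < 1) (ht' : ‖(t' : K)‖ < 1) :
    ptOf p K M t ht = ptOf p K M t' ht' := by
  obtain rfl : t = t' := Subtype.ext h
  rfl

variable [hint : (curveK p K M).IsIntegral (NormedField.valuation (K := K)).integer]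

/-- **`P(t) ∈ E₁(K)`** (`‖x(P(t))‖ = ‖t‖⁻² > 1`). [cite: SilvermanAEC2009, Prop. VII.2.2] -/
theorem ptOf_mem_kernel {t : unitBall K} (ht : ‖(t : K)‖ < 1) :
    ptOf p K M t ht ∈ kernel (NormedField.valuation (K := K)) (curveK p K M) := by
  by_cases ht0 : (t : K) = 0
  · rw [ptOf_of_eq_zero ht ht0]; exact (kernel (NormedField.valuation (K := K)) (curveK p K M)).zero_mem
  · rw [ptOf_of_ne_zero ht ht0]
    refine some_mem_kernel _ ?_
    rw [← NNReal.coe_lt_coe, NormedField.valuation_apply, coe_nnnorm, NNReal.coe_one, norm_div, norm_pow,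
      norm_evX (p := p) (M := M) ht]
    have h0 : 0 < ‖(t : K)‖ := norm_pos_iff.mpr ht0
    rw [lt_div_iff₀ (pow_pos h0 2), one_mul]
    nlinarith

omit hint in
/-- **`z(P(t)) = t`.** [cite: SilvermanAEC2009, Prop. VII.2.2] -/
theorem zCoord_ptOf {t : unitBall K} (ht : ‖(t : K)‖ < 1) : (ptOf p K M t ht).zCoord = (t : K) := by
  by_cases ht0 : (t : K) = 0
  · rw [ptOf_of_eq_zero ht ht0, ht0]; rfl
  · rw [ptOf_of_ne_zero ht ht0, Affine.Point.zCoord_some]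
    have hX := evX_ne_zero (p := p) (M := M) ht
    field_simp

omit [CompleteSpace K] hE in
/-- `‖z(P)‖ < 1` on `E₁(K)`. [cite: SilvermanAEC2009, IV.1] -/
theorem norm_zCoord_lt_one {P : (curveK p K M).toAffine.Point}
    (hP : P ∈ kernel (NormedField.valuation (K := K)) (curveK p K M)) : ‖P.zCoord‖ < 1 := by
  have h := val_zCoord_lt_one hP
  rwa [← NNReal.coe_lt_coe, NormedField.valuation_apply, coe_nnnorm, NNReal.coe_one] at h

/-- The parameter of a point of `E₁(K)` as an element of `𝒪_K`. [cite: SilvermanAEC2009, IV.1] -/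
def zBall (P : (curveK p K M).toAffine.Point)
    (hP : P ∈ kernel (NormedField.valuation (K := K)) (curveK p K M)) : unitBall K :=
  ⟨P.zCoord, (mem_unitBall_iff K).mpr (norm_zCoord_lt_one hP).le⟩

omit [CompleteSpace K] hE in
/-- `‖zBall P‖ < 1`. [cite: SilvermanAEC2009, IV.1] -/
theorem norm_zBall_lt_one {P : (curveK p K M).toAffine.Point}
    (hP : P ∈ kernel (NormedField.valuation (K := K)) (curveK p K M)) : ‖(zBall P hP : K)‖ < 1 :=
  norm_zCoord_lt_one hP

/-- **Every point of `E₁(K)` is the formal point of its parameter: `P = P(z(P))`** (injectivity of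
`z` on `E₁`, the tree's `zCoord_injOn`). [cite: SilvermanAEC2009, Prop. VII.2.2] -/
theorem eq_ptOf_zCoord {P : (curveK p K M).toAffine.Point}
    (hP : P ∈ kernel (NormedField.valuation (K := K)) (curveK p K M)) :
    P = ptOf p K M (zBall P hP) (norm_zBall_lt_one hP) :=
  zCoord_injOn hP (ptOf_mem_kernel _) (by rw [zCoord_ptOf]; rfl)

omit [CompleteSpace K] hE in
/-- Two points of `E₁(K)` with the same parameter are equal. [cite: SilvermanAEC2009, IV.1] -/
theorem eq_of_zCoord_eq {P Q : (curveK p K M).toAffine.Point}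
    (hP : P ∈ kernel (NormedField.valuation (K := K)) (curveK p K M))
    (hQ : Q ∈ kernel (NormedField.valuation (K := K)) (curveK p K M)) (h : P.zCoord = Q.zCoord) : P = Q :=
  zCoord_injOn hP hQ h

/-! ## §3 Negation: `−P(t) = P(i(t))` -/

omit hE hint in
/-- `i(t) ∈ 𝒪_K` has norm `≤ ‖t‖ < 1`. [cite: SilvermanAEC2009, IV.1] -/
theorem norm_ev₁_formalNeg_le {t : unitBall K} (ht : ‖(t : K)‖ < 1) :
    ‖((ev₁ p K t (hasEval_of_norm_lt_one ht) M.formalNeg : unitBall K) : K)‖ ≤ ‖(t : K)‖ :=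
  norm_ev₁_le _ ht.le M.constantCoeff_formalNeg

omit hE hint in
/-- `‖i(t)‖ < 1`. [cite: SilvermanAEC2009, IV.1] -/
theorem norm_ev₁_formalNeg_lt_one {t : unitBall K} (ht : ‖(t : K)‖ < 1) :
    ‖((ev₁ p K t (hasEval_of_norm_lt_one ht) M.formalNeg : unitBall K) : K)‖ < 1 :=
  (norm_ev₁_formalNeg_le ht).trans_lt ht

omit hE hint in
/-- `X(i(t))` is `X` evaluated at `i(t)` (substitution compatibility). [cite: SilvermanAEC2009, IV.1] -/
theorem ev₁_formalXMulSq_subst_formalNeg {t : unitBall K} (ht : ‖(t : K)‖ < 1) :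
    ((ev₁ p K t (hasEval_of_norm_lt_one ht) (M.formalXMulSq.subst M.formalNeg) : unitBall K) : K) =
      evX p M (ev₁ p K t (hasEval_of_norm_lt_one ht) M.formalNeg) (norm_ev₁_formalNeg_lt_one ht) := by
  rw [evX, ev₁_subst M.constantCoeff_formalNeg (hasEval_of_norm_lt_one ht)
    (hasEval_of_norm_lt_one (norm_ev₁_formalNeg_lt_one ht))]

omit hE hint in
/-- `i(t) ≠ 0` for `t ≠ 0` (`i(i(t)) = t`). [cite: SilvermanAEC2009, IV.1] -/
theorem ev₁_formalNeg_ne_zero {t : unitBall K} (ht : ‖(t : K)‖ < 1) (ht0 : (t : K) ≠ 0) :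
    ((ev₁ p K t (hasEval_of_norm_lt_one ht) M.formalNeg : unitBall K) : K) ≠ 0 := by
  intro h
  have hii := congrArg (fun f => ((ev₁ p K t (hasEval_of_norm_lt_one ht) f : unitBall K) : K))
    M.formalNeg_subst_formalNeg_eq_X
  simp only [ev₁_X] at hii
  rw [ev₁_subst M.constantCoeff_formalNeg (hasEval_of_norm_lt_one ht)
    (hasEval_of_norm_lt_one (norm_ev₁_formalNeg_lt_one ht))] at hii
  have h0 : (ev₁ p K t (hasEval_of_norm_lt_one ht) M.formalNeg : unitBall K) = 0 := Subtype.ext h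
  have : ((ev₁ p K (ev₁ p K t (hasEval_of_norm_lt_one ht) M.formalNeg)
      (hasEval_of_norm_lt_one (norm_ev₁_formalNeg_lt_one ht)) M.formalNeg : unitBall K) : K) = 0 := by
    have hle := norm_ev₁_le (p := p) (K := K) (hasEval_of_norm_lt_one (norm_ev₁_formalNeg_lt_one (M := M) ht))
      (norm_ev₁_formalNeg_lt_one ht).le M.constantCoeff_formalNeg
    rw [h, norm_zero] at hle
    exact norm_le_zero_iff.mp hle
  rw [this] at hii
  exact ht0 hii.symm

omit hint in
/-- **`−P(t) = P(i(t))`** (`x(i(z)) = x(z)`, `y(i(z)) = −y − a₁x − a₃`: the tree's formal identities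
`formalXMulSq_subst_formalNeg_mul_X_sq`, `formalXMulSq_mul_formalNeg_add` evaluated at `t`, then the
field algebra `neg_aux_x/y` of `FormalGroupLaurentPoints`). [cite: SilvermanAEC2009, IV.1] -/
theorem neg_ptOf {t : unitBall K} (ht : ‖(t : K)‖ < 1) :
    -ptOf p K M t ht = ptOf p K M (ev₁ p K t (hasEval_of_norm_lt_one ht) M.formalNeg)
      (norm_ev₁_formalNeg_lt_one ht) := by
  by_cases ht0 : (t : K) = 0
  · have hi0 : ((ev₁ p K t (hasEval_of_norm_lt_one ht) M.formalNeg : unitBall K) : K) = 0 := by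
      have hle := norm_ev₁_formalNeg_le (p := p) (M := M) ht
      rw [ht0, norm_zero] at hle
      exact norm_le_zero_iff.mp hle
    rw [ptOf_of_eq_zero ht ht0, neg_zero, ptOf_of_eq_zero _ hi0]
  have hi0 := ev₁_formalNeg_ne_zero (p := p) (M := M) ht ht0
  rw [ptOf_of_ne_zero ht ht0, ptOf_of_ne_zero _ hi0, Affine.Point.neg_some, Affine.Point.some.injEq]
  have h1 := congrArg (fun f => ((ev₁ p K t (hasEval_of_norm_lt_one ht) f : unitBall K) : K))
    M.formalXMulSq_subst_formalNeg_mul_X_sq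
  have h2 := congrArg (fun f => ((ev₁ p K t (hasEval_of_norm_lt_one ht) f : unitBall K) : K))
    M.formalXMulSq_mul_formalNeg_add
  simp only [map_mul, map_pow, map_add, map_sub, ev₁_X, ev₁_C, Subring.coe_mul, SubmonoidClass.coe_pow,
    Subring.coe_add, AddSubgroupClass.coe_sub] at h1 h2
  rw [ev₁_formalXMulSq_subst_formalNeg ht] at h1
  simp only [Affine.negY, curveK, map_a₁, map_a₃, RingHom.coe_comp, Function.comp_apply, Subring.coe_subtype]
  refine ⟨neg_aux_x ht0 hi0 h1, ?_⟩
  change -(-evX p M t ht / (t : K) ^ 3) - (coeffHom p K M.a₁ : K) * (evX p M t ht / (t : K) ^ 2) -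
      (coeffHom p K M.a₃ : K) = _
  exact neg_aux_y ht0 hi0 h1 h2

end BallEval

end Literature.NumberTheory.EllipticCurves.Sprung2012.Honda

end Part3

/-!
## Part 4 — port of `Summits/BirchSwinnertonDyer/Rank1Residual/Additive/FormalGroupBallPointsAdd.lean` (15 declarations kept)

# The formal group law computes `E₁(K)` for `K ⊇ ℚ_p` complete, I: evaluation of the chord and
# doubling identities at a pair of parameters, and the chord case `P(u) + P(v) = P(F(u, v))` for
# `x(P(u)) ≠ x(P(v))`

(Port of the declarations listed in the Part header; the source module's docstring — cell bookkeeping of the BSD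
printed-inputs programme — is abridged to its title here.)
-/

section Part4

open scoped _root_.Classical _root_.Topology _root_.NNReal
open _root_.Filter _root_.PowerSeries

namespace Literature.NumberTheory.EllipticCurves.Sprung2012.Honda

namespace BallEval

open Literature.NumberTheory.GaloisRepresentations.LubinTate (unitBall mem_unitBall_iff)
open Literature.NumberTheory.EllipticCurves Literature.NumberTheory.EllipticCurves.FormalGroupChart
open _root_.WeierstrassCurve

variable {p : ℕ} [hp : Fact p.Prime] {K : Type*} [NontriviallyNormedField K] [NormedAlgebra ℚ_[p] K]
  [IsUltrametricDist K] [CompleteSpace K] {M : WeierstrassCurve ℤ_[p]}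

/-! ## §1 `F(u, v)` and the evaluation dictionary -/

variable (p M) in
/-- **`F(u, v) ∈ 𝒪_K`**, the formal group law of `M` evaluated at a pair of points of the open disc.
[cite: SilvermanAEC2009, Prop. VII.2.2] -/
def evF (u v : unitBall K) (hu : ‖(u : K)‖ < 1) (hv : ‖(v : K)‖ < 1) : unitBall K :=
  ev p K ![u, v] (hasEval_pair hu hv) M.formalGroupLaw

/-- `‖F(u, v)‖ ≤ max ‖u‖ ‖v‖`. [cite: SilvermanAEC2009, IV.2] -/
theorem norm_evF_le {u v : unitBall K} (hu : ‖(u : K)‖ < 1) (hv : ‖(v : K)‖ < 1) :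
    ‖(evF p M u v hu hv : K)‖ ≤ max ‖(u : K)‖ ‖(v : K)‖ := by
  have h := norm_ev_le_of_constantCoeff_eq_zero (hasEval_pair hu hv) M.constantCoeff_formalGroupLaw
  rw [evF]
  refine h.trans (Finset.sup'_le _ _ fun i _ => ?_)
  fin_cases i
  · exact le_max_left _ _
  · exact le_max_right _ _

/-- `‖F(u, v)‖ < 1`. [cite: SilvermanAEC2009, IV.2] -/
theorem norm_evF_lt_one {u v : unitBall K} (hu : ‖(u : K)‖ < 1) (hv : ‖(v : K)‖ < 1) :
    ‖(evF p M u v hu hv : K)‖ < 1 :=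
  (norm_evF_le hu hv).trans_lt (max_lt hu hv)

/-- Dictionary (in `𝒪_K`): `ev (f(z₀)) = ev₁ u f` for a one-variable `f` read in the first variable. [cite: SilvermanAEC2009, IV.2] -/
theorem ev_subst_X₀ {u v : unitBall K} (hu : ‖(u : K)‖ < 1) (hv : ‖(v : K)‖ < 1) (f : ℤ_[p]⟦X⟧) :
    ev p K ![u, v] (hasEval_pair hu hv) (f.subst (MvPowerSeries.X 0 : MvPowerSeries (Fin 2) ℤ_[p])) =
      ev₁ p K u (hasEval_of_norm_lt_one hu) f := by
  apply Subtype.ext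
  rw [ev_powerSeries_subst (PowerSeries.HasSubst.X 0), ev₁_apply, ev_X]
  rfl

/-- Dictionary (in `𝒪_K`): `ev (f(z₁)) = ev₁ v f`. [cite: SilvermanAEC2009, IV.2] -/
theorem ev_subst_X₁ {u v : unitBall K} (hu : ‖(u : K)‖ < 1) (hv : ‖(v : K)‖ < 1) (f : ℤ_[p]⟦X⟧) :
    ev p K ![u, v] (hasEval_pair hu hv) (f.subst (MvPowerSeries.X 1 : MvPowerSeries (Fin 2) ℤ_[p])) =
      ev₁ p K v (hasEval_of_norm_lt_one hv) f := by
  apply Subtype.ext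
  rw [ev_powerSeries_subst (PowerSeries.HasSubst.X 1), ev₁_apply, ev_X]
  rfl

/-- Dictionary (in `𝒪_K`): `ev (f(F)) = ev₁ (F(u,v)) f`. [cite: SilvermanAEC2009, IV.2] -/
theorem ev_subst_formalGroupLaw {u v : unitBall K} (hu : ‖(u : K)‖ < 1) (hv : ‖(v : K)‖ < 1) (f : ℤ_[p]⟦X⟧) :
    ev p K ![u, v] (hasEval_pair hu hv) (f.subst M.formalGroupLaw) =
      ev₁ p K (evF p M u v hu hv) (hasEval_of_norm_lt_one (norm_evF_lt_one (p := p) (M := M) hu hv)) f := by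
  apply Subtype.ext
  rw [ev_powerSeries_subst (PowerSeries.HasSubst.of_constantCoeff_zero M.constantCoeff_formalGroupLaw), ev₁_apply]
  rfl

omit [NormedAlgebra ℚ_[p] K] [CompleteSpace K] hp in
/-- A constant `Unit`-indexed family at a point of the open disc is evaluable. [cite: SilvermanAEC2009, IV.2] -/
theorem hasEval_const {t : unitBall K} (ht : ‖(t : K)‖ < 1) : MvPowerSeries.HasEval (fun _ : Unit => t) :=
  mvHasEval_of_norm_lt_one fun _ => ht

/-- `ev₁ t` is `ev` at the constant family. [cite: SilvermanAEC2009, IV.2] -/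
theorem ev_const_eq_ev₁ {t : unitBall K} (ht : ‖(t : K)‖ < 1) :
    ev p K (fun _ : Unit => t) (hasEval_const ht) = ev₁ p K t (hasEval_of_norm_lt_one ht) := by
  ext f : 1
  rw [ev_apply, ev₁_apply]; rfl

/-- **Dictionary for pairs substituted into `F`**: `(G(g, h))(t) = G(g(t), h(t))` for one-variable
`g, h` without constant term. [cite: SilvermanAEC2009, IV.2] -/
theorem coe_ev₁_substPair {t : unitBall K} (ht : ‖(t : K)‖ < 1) {g h : ℤ_[p]⟦X⟧}
    (hg : PowerSeries.constantCoeff g = 0) (hh : PowerSeries.constantCoeff h = 0)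
    (hg' : ‖((ev₁ p K t (hasEval_of_norm_lt_one ht) g : unitBall K) : K)‖ < 1)
    (hh' : ‖((ev₁ p K t (hasEval_of_norm_lt_one ht) h : unitBall K) : K)‖ < 1)
    (G : MvPowerSeries (Fin 2) ℤ_[p]) :
    ((ev₁ p K t (hasEval_of_norm_lt_one ht) (MvPowerSeries.subst ![g, h] G) : unitBall K) : K) =
      ((ev p K ![ev₁ p K t (hasEval_of_norm_lt_one ht) g, ev₁ p K t (hasEval_of_norm_lt_one ht) h]
        (hasEval_pair hg' hh') G : unitBall K) : K) := by
  have h := ev_subst (K := K) (hasSubst_pair hg hh) (hasEval_const ht) G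
  rw [ev_const_eq_ev₁ (p := p) ht] at h
  rw [h, ev_apply]
  congr 2
  funext i
  fin_cases i <;> rfl

/-- **`F(t, 0) = t`** at points (the tree's `formalGroupLaw_subst_X_zero'` evaluated).
[cite: SilvermanAEC2009, IV.2] -/
theorem coe_evF_zero_right {t : unitBall K} (ht : ‖(t : K)‖ < 1) (h0 : ‖((0 : unitBall K) : K)‖ < 1) :
    (evF p M t 0 ht h0 : K) = t := by
  have h := congrArg (fun f => ((ev₁ p K t (hasEval_of_norm_lt_one ht) f : unitBall K) : K))
    M.formalGroupLaw_subst_X_zero'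
  simp only [ev₁_X] at h
  have hX' : ‖((ev₁ p K t (hasEval_of_norm_lt_one ht) PowerSeries.X : unitBall K) : K)‖ < 1 := by
    rw [ev₁_X]; exact ht
  have h0' : ‖((ev₁ p K t (hasEval_of_norm_lt_one ht) 0 : unitBall K) : K)‖ < 1 := by
    rw [map_zero]; exact h0
  rw [coe_ev₁_substPair ht PowerSeries.constantCoeff_X (map_zero _) hX' h0', ev_apply] at h
  rw [evF, ev_apply]
  have e : (![t, 0] : Fin 2 → unitBall K) =
      ![ev₁ p K t (hasEval_of_norm_lt_one ht) PowerSeries.X, ev₁ p K t (hasEval_of_norm_lt_one ht) 0] := by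
    funext i; fin_cases i <;> simp [ev₁_X]
  rw [e]; exact h

/-- **`F(0, t) = t`** at points (the tree's `formalGroupLaw_subst_zero` evaluated).
[cite: SilvermanAEC2009, IV.2] -/
theorem coe_evF_zero_left {t : unitBall K} (ht : ‖(t : K)‖ < 1) (h0 : ‖((0 : unitBall K) : K)‖ < 1) :
    (evF p M 0 t h0 ht : K) = t := by
  have hid : MvPowerSeries.subst ![(0 : ℤ_[p]⟦X⟧), PowerSeries.X] M.formalGroupLaw = PowerSeries.X :=
    M.formalGroupLaw_subst_zero PowerSeries.HasSubst.X'
  have h := congrArg (fun f => ((ev₁ p K t (hasEval_of_norm_lt_one ht) f : unitBall K) : K)) hid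
  simp only [ev₁_X] at h
  have hX' : ‖((ev₁ p K t (hasEval_of_norm_lt_one ht) PowerSeries.X : unitBall K) : K)‖ < 1 := by
    rw [ev₁_X]; exact ht
  have h0' : ‖((ev₁ p K t (hasEval_of_norm_lt_one ht) 0 : unitBall K) : K)‖ < 1 := by
    rw [map_zero]; exact h0
  rw [coe_ev₁_substPair ht (map_zero _) PowerSeries.constantCoeff_X h0' hX', ev_apply] at h
  rw [evF, ev_apply]
  have e : (![0, t] : Fin 2 → unitBall K) =
      ![ev₁ p K t (hasEval_of_norm_lt_one ht) 0, ev₁ p K t (hasEval_of_norm_lt_one ht) PowerSeries.X] := by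
    funext i; fin_cases i <;> simp [ev₁_X]
  rw [e]; exact h

/-- **`F(t, i(t)) = 0`** at points (the tree's `formalGroupLaw_subst_X_formalNeg'` evaluated).
[cite: SilvermanAEC2009, IV.2] -/
theorem coe_evF_formalNeg {t : unitBall K} (ht : ‖(t : K)‖ < 1) :
    (evF p M t (ev₁ p K t (hasEval_of_norm_lt_one ht) M.formalNeg) ht (norm_ev₁_formalNeg_lt_one ht) : K)
      = 0 := by
  have h := congrArg (fun f => ((ev₁ p K t (hasEval_of_norm_lt_one ht) f : unitBall K) : K))
    M.formalGroupLaw_subst_X_formalNeg'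
  simp only [map_zero, Subring.coe_zero] at h
  have hX' : ‖((ev₁ p K t (hasEval_of_norm_lt_one ht) PowerSeries.X : unitBall K) : K)‖ < 1 := by
    rw [ev₁_X]; exact ht
  rw [coe_ev₁_substPair ht PowerSeries.constantCoeff_X M.constantCoeff_formalNeg hX'
    (norm_ev₁_formalNeg_lt_one ht), ev_apply] at h
  rw [evF, ev_apply]
  have e : (![t, ev₁ p K t (hasEval_of_norm_lt_one ht) M.formalNeg] : Fin 2 → unitBall K) =
      ![ev₁ p K t (hasEval_of_norm_lt_one ht) PowerSeries.X, ev₁ p K t (hasEval_of_norm_lt_one ht) M.formalNeg] := by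
    funext i; fin_cases i <;> simp [ev₁_X]
  rw [e]; exact h

/-! ## §2 The chord case -/

variable [hE : (M.map PadicInt.Coe.ringHom).IsElliptic]

/-- **The chord identity for `x`, at `(u, v)`** (`formalXMulSq_formalGroupLaw_chord` evaluated).
[cite: SilvermanAEC2009, IV.1] -/
theorem chordX_at {u v : unitBall K} (hu : ‖(u : K)‖ < 1) (hv : ‖(v : K)‖ < 1) :
    evX p M (evF p M u v hu hv) (norm_evF_lt_one hu hv) *
        (evX p M u hu * (v : K) ^ 2 - evX p M v hv * (u : K) ^ 2) ^ 2 * (u : K) ^ 2 * (v : K) ^ 2 =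
      (evF p M u v hu hv : K) ^ 2 *
        ((evX p M v hv * (u : K) ^ 3 - evX p M u hu * (v : K) ^ 3) ^ 2 +
            (coeffHom p K M.a₁ : K) * (evX p M v hv * (u : K) ^ 3 - evX p M u hu * (v : K) ^ 3) *
              (evX p M u hu * (v : K) ^ 2 - evX p M v hv * (u : K) ^ 2) * (u : K) * (v : K) -
          ((coeffHom p K M.a₂ : K) * (u : K) ^ 2 * (v : K) ^ 2 + evX p M u hu * (v : K) ^ 2 +
              evX p M v hv * (u : K) ^ 2) *
            (evX p M u hu * (v : K) ^ 2 - evX p M v hv * (u : K) ^ 2) ^ 2) := by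
  have h := congrArg (ev p K ![u, v] (hasEval_pair hu hv)) M.formalXMulSq_formalGroupLaw_chord
  simp only [map_mul, map_pow, map_add, map_sub, ev_X, ev_C, Matrix.cons_val_zero, Matrix.cons_val_one] at h
  rw [ev_subst_X₀ hu hv M.formalXMulSq, ev_subst_X₁ hu hv M.formalXMulSq,
    ev_subst_formalGroupLaw hu hv M.formalXMulSq] at h
  have h' := congrArg Subtype.val h
  simp only [Subring.coe_mul, SubmonoidClass.coe_pow, Subring.coe_add, AddSubgroupClass.coe_sub] at h'
  exact h'

/-- **The chord identity for `y`, at `(u, v)`** (`formalXMulSq_formalGroupLaw_chordY` evaluated).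
[cite: SilvermanAEC2009, IV.1] -/
theorem chordY_at {u v : unitBall K} (hu : ‖(u : K)‖ < 1) (hv : ‖(v : K)‖ < 1) :
    (-evX p M (evF p M u v hu hv) (norm_evF_lt_one hu hv) +
          (coeffHom p K M.a₁ : K) * evX p M (evF p M u v hu hv) (norm_evF_lt_one hu hv) * (evF p M u v hu hv : K) +
          (coeffHom p K M.a₃ : K) * (evF p M u v hu hv : K) ^ 3) *
        (evX p M u hu * (v : K) ^ 2 - evX p M v hv * (u : K) ^ 2) * (u : K) ^ 3 * (v : K) =
      -((evX p M v hv * (u : K) ^ 3 - evX p M u hu * (v : K) ^ 3) *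
          (evX p M (evF p M u v hu hv) (norm_evF_lt_one hu hv) * (u : K) ^ 2 -
            evX p M u hu * (evF p M u v hu hv : K) ^ 2) * (evF p M u v hu hv : K)) +
        evX p M u hu * (evX p M u hu * (v : K) ^ 2 - evX p M v hv * (u : K) ^ 2) *
          (evF p M u v hu hv : K) ^ 3 * (v : K) := by
  have h := congrArg (ev p K ![u, v] (hasEval_pair hu hv)) M.formalXMulSq_formalGroupLaw_chordY
  simp only [map_mul, map_pow, map_add, map_sub, map_neg, ev_X, ev_C, Matrix.cons_val_zero,
    Matrix.cons_val_one] at h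
  rw [ev_subst_X₀ hu hv M.formalXMulSq, ev_subst_X₁ hu hv M.formalXMulSq,
    ev_subst_formalGroupLaw hu hv M.formalXMulSq] at h
  have h' := congrArg Subtype.val h
  simp only [Subring.coe_mul, SubmonoidClass.coe_pow, Subring.coe_add, AddSubgroupClass.coe_sub,
    NegMemClass.coe_neg] at h'
  exact h'

variable [hint : (curveK p K M).IsIntegral (NormedField.valuation (K := K)).integer]

omit hint in
/-- **`P(u) + P(v) = P(F(u, v))` when `x(P(u)) ≠ x(P(v))`** (the chord case; `u, v ≠ 0`).
[cite: SilvermanAEC2009, Prop. VII.2.2] -/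
theorem ptOf_add_of_x_ne {u v : unitBall K} (hu : ‖(u : K)‖ < 1) (hv : ‖(v : K)‖ < 1)
    (hu0 : (u : K) ≠ 0) (hv0 : (v : K) ≠ 0)
    (hx : evX p M u hu / (u : K) ^ 2 ≠ evX p M v hv / (v : K) ^ 2) :
    ptOf p K M u hu + ptOf p K M v hv = ptOf p K M (evF p M u v hu hv) (norm_evF_lt_one hu hv) := by
  have keyX := chordX_at (p := p) (M := M) hu hv
  have keyY := chordY_at (p := p) (M := M) hu hv
  set F : K := (evF p M u v hu hv : K) with hFdef
  set X₀ : K := evX p M u hu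
  set X₁ : K := evX p M v hv
  set XF : K := evX p M (evF p M u v hu hv) (norm_evF_lt_one hu hv)
  -- `F ≠ 0`
  have hxs : X₀ * (v : K) ^ 2 - X₁ * (u : K) ^ 2 ≠ 0 := by
    intro h0
    apply hx
    rw [div_eq_div_iff (pow_ne_zero 2 hu0) (pow_ne_zero 2 hv0)]
    linear_combination h0
  have hF0 : F ≠ 0 := by
    intro hF
    have hXF : XF = 1 := by
      have h1 := norm_evX_sub_one_le (p := p) (M := M) (norm_evF_lt_one (p := p) (M := M) hu hv)
      rw [← hFdef, hF, norm_zero] at h1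
      exact sub_eq_zero.mp (norm_le_zero_iff.mp h1)
    rw [hF, hXF] at keyX
    have : (X₀ * (v : K) ^ 2 - X₁ * (u : K) ^ 2) ^ 2 * (u : K) ^ 2 * (v : K) ^ 2 = 0 := by
      linear_combination keyX
    simp only [mul_eq_zero, pow_eq_zero_iff, ne_eq, OfNat.ofNat_ne_zero, not_false_eq_true] at this
    rcases this with (h | h) | h
    · exact hxs h
    · exact hu0 h
    · exact hv0 h
  rw [ptOf_of_ne_zero hu hu0, ptOf_of_ne_zero hv hv0, ptOf_of_ne_zero _ hF0, Affine.Point.add_of_X_ne hx]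
  simp only [Affine.Point.some.injEq]
  have hcX := chart_chordX hu0 hv0 hF0 keyX
  have hcY := chart_chordY hu0 hv0 hF0 keyY
  have haddX := chord_addX_mul (curveK p K M) (-X₀ / (u : K) ^ 3) (-X₁ / (v : K) ^ 3) hx
  have haddY := chord_addY_mul (curveK p K M) (-X₀ / (u : K) ^ 3) (-X₁ / (v : K) ^ 3) hx
  simp only [curveK, map_a₁, map_a₂, map_a₃, RingHom.coe_comp, Function.comp_apply, Subring.coe_subtype]
    at haddX haddY hcX hcY ⊢
  have hD : X₀ / (u : K) ^ 2 - X₁ / (v : K) ^ 2 ≠ 0 := sub_ne_zero.mpr hx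
  have hX3 := mul_right_cancel₀ (pow_ne_zero 2 hD) (haddX.trans hcX.symm)
  refine ⟨hX3, ?_⟩
  rw [hX3] at haddY
  have hY3 := mul_right_cancel₀ hD (haddY.trans hcY.symm)
  linear_combination hY3

end BallEval

end Literature.NumberTheory.EllipticCurves.Sprung2012.Honda

end Part4

/-!
## Part 5 — port of `Summits/BirchSwinnertonDyer/Rank1Residual/Additive/FormalGroupBallPointsAddII.lean` (10 declarations kept)

# The formal group law computes `E₁(K)` for `K ⊇ ℚ_p` complete, II: the tangent case and the
# theorem `z(P + Q) = F(z(P), z(Q))` on `E₁(K)`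

(Port of the declarations listed in the Part header; the source module's docstring — cell bookkeeping of the BSD
printed-inputs programme — is abridged to its title here.)
-/

section Part5

open scoped _root_.Classical _root_.Topology _root_.NNReal
open _root_.Filter _root_.PowerSeries

namespace Literature.NumberTheory.EllipticCurves.Sprung2012.Honda

namespace BallEval

open Literature.NumberTheory.GaloisRepresentations.LubinTate (unitBall mem_unitBall_iff)
open Literature.NumberTheory.EllipticCurves Literature.NumberTheory.EllipticCurves.FormalGroupChart
open _root_.WeierstrassCurve

variable {p : ℕ} [hp : Fact p.Prime] {K : Type*} [NontriviallyNormedField K] [NormedAlgebra ℚ_[p] K]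
  [IsUltrametricDist K] [CompleteSpace K] {M : WeierstrassCurve ℤ_[p]}

/-! ## §1 The tangent case -/

/-- `‖[2](t)‖ < 1`. [cite: SilvermanAEC2009, IV.2] -/
theorem norm_ev₁_formalMul_lt_one {t : unitBall K} (ht : ‖(t : K)‖ < 1) (n : ℕ) :
    ‖((ev₁ p K t (hasEval_of_norm_lt_one ht) (M.formalMul n) : unitBall K) : K)‖ < 1 :=
  (norm_ev₁_le _ ht.le (M.constantCoeff_formalMul n)).trans_lt ht

/-- Dictionary (in `𝒪_K`): `ev₁ t (X([n])) = ev₁ ([n](t)) X`. [cite: SilvermanAEC2009, IV.2] -/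
theorem ev₁_formalXMulSq_subst_formalMul {t : unitBall K} (ht : ‖(t : K)‖ < 1) (n : ℕ) :
    ev₁ p K t (hasEval_of_norm_lt_one ht) (M.formalXMulSq.subst (M.formalMul n)) =
      ev₁ p K (ev₁ p K t (hasEval_of_norm_lt_one ht) (M.formalMul n))
        (hasEval_of_norm_lt_one (norm_ev₁_formalMul_lt_one (p := p) (M := M) ht n)) M.formalXMulSq :=
  ev₁_subst (M.constantCoeff_formalMul n) (hasEval_of_norm_lt_one ht) _ _

/-- **`F(t, t) = [2](t)`** at points (`formalMul_two`). [cite: SilvermanAEC2009, IV.2] -/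
theorem coe_evF_self {t : unitBall K} (ht : ‖(t : K)‖ < 1) :
    (evF p M t t ht ht : K) = ((ev₁ p K t (hasEval_of_norm_lt_one ht) (M.formalMul 2) : unitBall K) : K) := by
  have hX' : ‖((ev₁ p K t (hasEval_of_norm_lt_one ht) PowerSeries.X : unitBall K) : K)‖ < 1 := by
    rw [ev₁_X]; exact ht
  rw [M.formalMul_two, coe_ev₁_substPair ht PowerSeries.constantCoeff_X PowerSeries.constantCoeff_X hX' hX',
    ev_apply, evF, ev_apply]
  have e : (![t, t] : Fin 2 → unitBall K) =
      ![ev₁ p K t (hasEval_of_norm_lt_one ht) PowerSeries.X, ev₁ p K t (hasEval_of_norm_lt_one ht) PowerSeries.X] := by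
    funext i; fin_cases i <;> simp [ev₁_X]
  rw [e]

variable [hE : (M.map PadicInt.Coe.ringHom).IsElliptic]

/-- **The doubling identity for `x`, at `t`** (`formalXMulSq_formalMul_two` evaluated; `A = X(t)`,
`D = [2](t)`, `s = t`). [cite: SilvermanAEC2009, IV.2] -/
theorem doubleX_at {t : unitBall K} (ht : ‖(t : K)‖ < 1) :
    evX p M (ev₁ p K t (hasEval_of_norm_lt_one ht) (M.formalMul 2)) (norm_ev₁_formalMul_lt_one ht 2) *
        (t : K) ^ 2 *
        (((coeffHom p K M.a₁ : K) * (t : K) - 2) * evX p M t ht + (coeffHom p K M.a₃ : K) * (t : K) ^ 3) ^ 2 =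
      ((ev₁ p K t (hasEval_of_norm_lt_one ht) (M.formalMul 2) : unitBall K) : K) ^ 2 *
        ((3 * evX p M t ht ^ 2 + 2 * (coeffHom p K M.a₂ : K) * (t : K) ^ 2 * evX p M t ht +
              (coeffHom p K M.a₄ : K) * (t : K) ^ 4 + (coeffHom p K M.a₁ : K) * (t : K) * evX p M t ht) ^ 2 +
            (coeffHom p K M.a₁ : K) *
              (3 * evX p M t ht ^ 2 + 2 * (coeffHom p K M.a₂ : K) * (t : K) ^ 2 * evX p M t ht +
                (coeffHom p K M.a₄ : K) * (t : K) ^ 4 + (coeffHom p K M.a₁ : K) * (t : K) * evX p M t ht) *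
              (t : K) * (((coeffHom p K M.a₁ : K) * (t : K) - 2) * evX p M t ht + (coeffHom p K M.a₃ : K) * (t : K) ^ 3) -
          (coeffHom p K M.a₂ : K) * (t : K) ^ 2 *
            (((coeffHom p K M.a₁ : K) * (t : K) - 2) * evX p M t ht + (coeffHom p K M.a₃ : K) * (t : K) ^ 3) ^ 2 -
          2 * evX p M t ht *
            (((coeffHom p K M.a₁ : K) * (t : K) - 2) * evX p M t ht + (coeffHom p K M.a₃ : K) * (t : K) ^ 3) ^ 2) := by
  have h := congrArg (ev₁ p K t (hasEval_of_norm_lt_one ht)) M.formalXMulSq_formalMul_two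
  simp only [map_mul, map_pow, map_add, map_sub, map_ofNat, ev₁_X, ev₁_C] at h
  rw [ev₁_formalXMulSq_subst_formalMul ht 2] at h
  have h' := congrArg Subtype.val h
  simp only [Subring.coe_mul, SubmonoidClass.coe_pow, Subring.coe_add, AddSubgroupClass.coe_sub] at h'
  exact h'

/-- **The doubling identity for `y`, at `t`** (`formalXMulSq_formalMul_twoY` evaluated).
[cite: SilvermanAEC2009, IV.2] -/
theorem doubleY_at {t : unitBall K} (ht : ‖(t : K)‖ < 1) :
    (-evX p M (ev₁ p K t (hasEval_of_norm_lt_one ht) (M.formalMul 2)) (norm_ev₁_formalMul_lt_one ht 2) +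
          (coeffHom p K M.a₁ : K) *
              evX p M (ev₁ p K t (hasEval_of_norm_lt_one ht) (M.formalMul 2)) (norm_ev₁_formalMul_lt_one ht 2) *
            ((ev₁ p K t (hasEval_of_norm_lt_one ht) (M.formalMul 2) : unitBall K) : K) +
          (coeffHom p K M.a₃ : K) * ((ev₁ p K t (hasEval_of_norm_lt_one ht) (M.formalMul 2) : unitBall K) : K) ^ 3) *
        (t : K) ^ 3 * (((coeffHom p K M.a₁ : K) * (t : K) - 2) * evX p M t ht + (coeffHom p K M.a₃ : K) * (t : K) ^ 3) =
      -((3 * evX p M t ht ^ 2 + 2 * (coeffHom p K M.a₂ : K) * (t : K) ^ 2 * evX p M t ht +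
              (coeffHom p K M.a₄ : K) * (t : K) ^ 4 + (coeffHom p K M.a₁ : K) * (t : K) * evX p M t ht) *
          (evX p M (ev₁ p K t (hasEval_of_norm_lt_one ht) (M.formalMul 2)) (norm_ev₁_formalMul_lt_one ht 2) *
              (t : K) ^ 2 -
            evX p M t ht * ((ev₁ p K t (hasEval_of_norm_lt_one ht) (M.formalMul 2) : unitBall K) : K) ^ 2) *
          ((ev₁ p K t (hasEval_of_norm_lt_one ht) (M.formalMul 2) : unitBall K) : K)) +
        evX p M t ht * ((ev₁ p K t (hasEval_of_norm_lt_one ht) (M.formalMul 2) : unitBall K) : K) ^ 3 *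
          (((coeffHom p K M.a₁ : K) * (t : K) - 2) * evX p M t ht + (coeffHom p K M.a₃ : K) * (t : K) ^ 3) := by
  have h := congrArg (ev₁ p K t (hasEval_of_norm_lt_one ht)) M.formalXMulSq_formalMul_twoY
  simp only [map_mul, map_pow, map_add, map_sub, map_neg, map_ofNat, ev₁_X, ev₁_C] at h
  rw [ev₁_formalXMulSq_subst_formalMul ht 2] at h
  have h' := congrArg Subtype.val h
  simp only [Subring.coe_mul, SubmonoidClass.coe_pow, Subring.coe_add, AddSubgroupClass.coe_sub,
    NegMemClass.coe_neg] at h'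
  exact h'

omit hE in
/-- `evX` depends only on the point. [cite: SilvermanAEC2009, IV.2] -/
theorem evX_congr {t t' : unitBall K} (h : t = t') (ht : ‖(t : K)‖ < 1) (ht' : ‖(t' : K)‖ < 1) :
    evX p M t ht = evX p M t' ht' := by
  subst h; rfl

/-- `P(t) = P(t')` forces `t = t'` (read off `z`). [cite: SilvermanAEC2009, IV.2] -/
theorem coe_eq_of_ptOf_eq {t t' : unitBall K} (ht : ‖(t : K)‖ < 1) (ht' : ‖(t' : K)‖ < 1)
    (h : ptOf p K M t ht = ptOf p K M t' ht') : (t : K) = t' := by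
  have := congrArg Affine.Point.zCoord h
  rwa [zCoord_ptOf, zCoord_ptOf] at this

/-- **`P(t) + P(t) = P(F(t, t))`** (the tangent case, including the `2`-torsion sub-case
`P(t) = −P(t)`, where `t = i(t)` and `F(t, i(t)) = 0`). [cite: SilvermanAEC2009, Prop. VII.2.2] -/
theorem ptOf_add_self {t : unitBall K} (ht : ‖(t : K)‖ < 1) (ht0 : (t : K) ≠ 0) :
    ptOf p K M t ht + ptOf p K M t ht = ptOf p K M (evF p M t t ht ht) (norm_evF_lt_one ht ht) := by
  set A : K := evX p M t ht with hAdef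
  set s : K := (t : K) with hsdef
  by_cases hy : -A / s ^ 3 = (curveK p K M).toAffine.negY (A / s ^ 2) (-A / s ^ 3)
  · -- `P(t) = -P(t)`: then `t = i(t)` and `F(t, t) = F(t, i(t)) = 0`
    have hneg : -ptOf p K M t ht = ptOf p K M t ht := by
      rw [ptOf_of_ne_zero ht ht0, Affine.Point.neg_some]
      simp only [Affine.Point.some.injEq]
      exact ⟨trivial, hy.symm⟩
    have hti : (t : K) = ((ev₁ p K t (hasEval_of_norm_lt_one ht) M.formalNeg : unitBall K) : K) := by
      refine coe_eq_of_ptOf_eq (p := p) (M := M) ht (norm_ev₁_formalNeg_lt_one ht) ?_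
      rw [← neg_ptOf ht, hneg]
    have hF0 : (evF p M t t ht ht : K) = 0 := by
      have h := coe_evF_formalNeg (p := p) (M := M) ht
      have e : (ev₁ p K t (hasEval_of_norm_lt_one ht) M.formalNeg : unitBall K) = t := Subtype.ext hti.symm
      simp only [e] at h
      exact h
    rw [ptOf_of_eq_zero _ hF0]
    nth_rewrite 1 [← hneg]
    exact neg_add_cancel _
  -- the genuine tangent case
  have keyX := doubleX_at (p := p) (M := M) ht
  have keyY := doubleY_at (p := p) (M := M) ht
  rw [← coe_evF_self ht] at keyX keyY
  set D : K := (evF p M t t ht ht : K) with hDdef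
  set XD : K := evX p M (evF p M t t ht ht) (norm_evF_lt_one ht ht) with hXDdef
  have hXD' : evX p M (ev₁ p K t (hasEval_of_norm_lt_one ht) (M.formalMul 2)) (norm_ev₁_formalMul_lt_one ht 2)
      = XD := by
    rw [hXDdef]
    exact evX_congr (Subtype.ext (coe_evF_self (p := p) (M := M) ht).symm) _ _
  rw [hXD'] at keyX keyY
  -- `Ỹ(t) = s³ (y − negY) ≠ 0`
  set Yt : K := ((coeffHom p K M.a₁ : K) * s - 2) * A + (coeffHom p K M.a₃ : K) * s ^ 3 with hYtdef
  have hYte : Yt = s ^ 3 * (-A / s ^ 3 - (curveK p K M).toAffine.negY (A / s ^ 2) (-A / s ^ 3)) := by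
    simp only [Affine.negY, curveK, map_a₁, map_a₃, RingHom.coe_comp, Function.comp_apply, Subring.coe_subtype]
    exact formalYTilde_chart _ _ _ _ ht0
  have hYt0 : Yt ≠ 0 := by
    rw [hYte]; exact mul_ne_zero (pow_ne_zero 3 ht0) (sub_ne_zero.mpr hy)
  -- `D ≠ 0`
  have hD0 : D ≠ 0 := by
    intro hD
    have hXD1 : XD = 1 := by
      have h1 := norm_evX_sub_one_le (p := p) (M := M) (norm_evF_lt_one (p := p) (M := M) ht ht)
      rw [← hDdef, hD, norm_zero] at h1
      exact sub_eq_zero.mp (norm_le_zero_iff.mp h1)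
    rw [hD, hXD1] at keyX
    have : s ^ 2 * Yt ^ 2 = 0 := by linear_combination keyX
    simp only [mul_eq_zero, pow_eq_zero_iff, ne_eq, OfNat.ofNat_ne_zero, not_false_eq_true] at this
    rcases this with h | h
    · exact ht0 h
    · exact hYt0 h
  rw [ptOf_of_ne_zero ht ht0, ptOf_of_ne_zero _ hD0, Affine.Point.add_self_of_Y_ne hy]
  simp only [Affine.Point.some.injEq]
  have hcX := chart_doubleX ht0 hD0 keyX
  have hcY := chart_doubleY ht0 hD0 keyY
  have htanX := tangent_addX_mul (curveK p K M) hy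
  have htanY := tangent_addY_mul (curveK p K M) hy
  simp only [curveK, map_a₁, map_a₂, map_a₃, map_a₄, RingHom.coe_comp, Function.comp_apply,
    Subring.coe_subtype, Affine.negY] at htanX htanY hcX hcY hy ⊢
  have hDy : -A / s ^ 3 - (-(-A / s ^ 3) - (coeffHom p K M.a₁ : K) * (A / s ^ 2) - (coeffHom p K M.a₃ : K)) ≠ 0 :=
    sub_ne_zero.mpr hy
  have hX3 := mul_right_cancel₀ (pow_ne_zero 2 hDy) (htanX.trans hcX.symm)
  refine ⟨hX3, ?_⟩
  rw [hX3] at htanY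
  have hY3 := mul_right_cancel₀ hDy (htanY.trans hcY.symm)
  linear_combination hY3

/-! ## §2 The group law on `E₁(K)` -/

/-- **`P(u) + P(v) = P(F(u, v))` for all `u, v` in the open disc.** [cite: SilvermanAEC2009, Prop. VII.2.2] -/
theorem ptOf_add {u v : unitBall K} (hu : ‖(u : K)‖ < 1) (hv : ‖(v : K)‖ < 1) :
    ptOf p K M u hu + ptOf p K M v hv = ptOf p K M (evF p M u v hu hv) (norm_evF_lt_one hu hv) := by
  by_cases hu0 : (u : K) = 0
  · obtain rfl : u = 0 := Subtype.ext hu0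
    rw [ptOf_of_eq_zero hu rfl, zero_add]
    exact ptOf_congr (coe_evF_zero_left hv hu).symm _ _
  by_cases hv0 : (v : K) = 0
  · obtain rfl : v = 0 := Subtype.ext hv0
    rw [ptOf_of_eq_zero hv rfl, add_zero]
    exact ptOf_congr (coe_evF_zero_right hu hv).symm _ _
  by_cases hx : evX p M u hu / (u : K) ^ 2 = evX p M v hv / (v : K) ^ 2
  · rcases Affine.Y_eq_of_X_eq (equation_ptOf p K M hu hu0) (equation_ptOf p K M hv hv0) hx with hy | hy
    · -- `P(v) = P(u)`: `v = u`, tangent case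
      have huv : (u : K) = v := by
        refine coe_eq_of_ptOf_eq (p := p) (M := M) hu hv ?_
        rw [ptOf_of_ne_zero hu hu0, ptOf_of_ne_zero hv hv0]
        simp only [Affine.Point.some.injEq]
        exact ⟨hx, hy⟩
      obtain rfl : u = v := Subtype.ext huv
      exact ptOf_add_self hu hu0
    · -- `P(v) = -P(u) = P(i(u))`: `v = i(u)`, `F(u, i(u)) = 0`
      have hvi : (v : K) = ((ev₁ p K u (hasEval_of_norm_lt_one hu) M.formalNeg : unitBall K) : K) := by
        refine coe_eq_of_ptOf_eq (p := p) (M := M) hv (norm_ev₁_formalNeg_lt_one hu) ?_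
        rw [← neg_ptOf hu, ptOf_of_ne_zero hu hu0, ptOf_of_ne_zero hv hv0, Affine.Point.neg_some]
        simp only [Affine.Point.some.injEq]
        exact ⟨hx.symm, by rw [hy, ← hx, Affine.negY_negY]⟩
      obtain rfl : v = ev₁ p K u (hasEval_of_norm_lt_one hu) M.formalNeg := Subtype.ext hvi
      rw [← neg_ptOf hu, add_neg_cancel, ptOf_of_eq_zero _ (coe_evF_formalNeg hu)]
  · exact ptOf_add_of_x_ne hu hv hu0 hv0 hx

variable [hint : (curveK p K M).IsIntegral (NormedField.valuation (K := K)).integer]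

/-- **The formal group law computes `E₁(K)`: `z(P + Q) = F(z(P), z(Q))`** for `P, Q ∈ E₁(K)`, `K`
any complete ultrametric normed field over `ℚ_p` (Silverman AEC VII.2.2, there for the completion of
a number field / `ℚ_p`; the tree had it for `K = ℚ_p` only, `formalGroupLaw_padicEval_holds`).
[cite: SilvermanAEC2009, Prop. VII.2.2] -/
theorem zCoord_add_eq_evF {P Q : (curveK p K M).toAffine.Point}
    (hP : P ∈ kernel (NormedField.valuation (K := K)) (curveK p K M))
    (hQ : Q ∈ kernel (NormedField.valuation (K := K)) (curveK p K M)) :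
    (P + Q).zCoord = (evF p M (zBall P hP) (zBall Q hQ) (norm_zBall_lt_one hP) (norm_zBall_lt_one hQ) : K) := by
  conv_lhs => rw [eq_ptOf_zCoord hP, eq_ptOf_zCoord hQ]
  rw [ptOf_add, zCoord_ptOf]

end BallEval

end Literature.NumberTheory.EllipticCurves.Sprung2012.Honda

end Part5

/-!
## Part 6 — port of `Summits/BirchSwinnertonDyer/Rank1Residual/Additive/PadicBallFubini.lean` (13 declarations kept)

# Evaluation of a NON-integral outer series at the value of an integral inner one:
# `∑ₙ aₙ g(t)ⁿ = ∑ₘ (f ∘ g)ₘ tᵐ` for `f = ∑ aₙXⁿ ∈ ℚ_p⟦X⟧` with `‖aₙ‖ ≤ n`, `g ∈ Xℤ_p⟦X⟧`, `‖t‖ < 1`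
# in a complete ultrametric normed `ℚ_p`-algebra (cell `b2b-bsdres`, CLASS-CLOSURE lane, class O10 —
# x1b GEN 33, class lead; file 25 of the local series: the "Fubini" step behind
# `log_E([n](z(P))) = n·log_E(z(P))` and `log_E(i(x)) = log_{F_ss}(x)` at `ℚ̄_p`-points)

(Port of the declarations listed in the Part header; the source module's docstring — cell bookkeeping of the BSD
printed-inputs programme — is abridged to its title here.)
-/

section Part6

open scoped _root_.Classical _root_.Topology
open _root_.Filter _root_.PowerSeries

namespace Literature.NumberTheory.EllipticCurves.Sprung2012.Honda

namespace BallEval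

open Literature.NumberTheory.GaloisRepresentations.LubinTate (unitBall mem_unitBall_iff)

variable (p : ℕ) [hp : Fact p.Prime] (K : Type*) [NontriviallyNormedField K] [NormedAlgebra ℚ_[p] K]
  [IsUltrametricDist K] [CompleteSpace K]

/-! ## §1 `qEval`: sums of `ℚ_p`-series with logarithmic growth -/

/-- **`qEval K f u = ∑ₙ φ(fₙ) uⁿ`**, the value at `u ∈ K` of a one-variable `ℚ_p`-series (meant for
`‖fₙ‖ ≤ n` and `‖u‖ < 1`, where the series converges). [cite: SilvermanAEC2009, IV.6.3] -/
def qEval (f : ℚ_[p]⟦X⟧) (u : K) : K := ∑' n : ℕ, algebraMap ℚ_[p] K (coeff n f) * u ^ n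

variable {p K}

omit [IsUltrametricDist K] [CompleteSpace K] in
/-- The termwise bound `‖φ(fₙ)uⁿ‖ ≤ n rⁿ` for `‖fₙ‖ ≤ n`, `‖u‖ ≤ r`. [cite: SilvermanAEC2009, IV.6.3] -/
theorem norm_term_le {f : ℚ_[p]⟦X⟧} (hf : ∀ n, ‖coeff n f‖ ≤ n) {u : K} {r : ℝ} (hu : ‖u‖ ≤ r) (n : ℕ) :
    ‖algebraMap ℚ_[p] K (coeff n f) * u ^ n‖ ≤ n * r ^ n := by
  rw [norm_mul, norm_pow, norm_algebraMap_padic]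
  exact mul_le_mul (hf n) (pow_le_pow_left₀ (norm_nonneg _) hu n) (pow_nonneg (norm_nonneg _) _)
    (Nat.cast_nonneg _)

omit [IsUltrametricDist K] in
/-- **Summability** of `∑ φ(fₙ)uⁿ` for `‖fₙ‖ ≤ n`, `‖u‖ < 1` (majorant `n‖u‖ⁿ`). [cite: SilvermanAEC2009, IV.6.3] -/
theorem summable_qEval {f : ℚ_[p]⟦X⟧} (hf : ∀ n, ‖coeff n f‖ ≤ n) {u : K} (hu : ‖u‖ < 1) :
    Summable fun n : ℕ => algebraMap ℚ_[p] K (coeff n f) * u ^ n := by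
  refine Summable.of_norm_bounded (g := fun n : ℕ => (n : ℝ) * ‖u‖ ^ n) ?_ (fun n => norm_term_le hf le_rfl n)
  have h := summable_pow_mul_geometric_of_norm_lt_one 1 (r := ‖u‖) (by rwa [norm_norm])
  simpa [pow_one] using h

omit [IsUltrametricDist K] in
/-- The defining sum. [cite: SilvermanAEC2009, IV.6.3] -/
theorem hasSum_qEval {f : ℚ_[p]⟦X⟧} (hf : ∀ n, ‖coeff n f‖ ≤ n) {u : K} (hu : ‖u‖ < 1) :
    HasSum (fun n : ℕ => algebraMap ℚ_[p] K (coeff n f) * u ^ n) (qEval p K f u) :=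
  (summable_qEval hf hu).hasSum

omit [IsUltrametricDist K] [CompleteSpace K] in
/-- `f₀ = 0` when `‖fₙ‖ ≤ n`. [cite: SilvermanAEC2009, IV.6.3] -/
theorem coeff_zero_eq_zero {f : ℚ_[p]⟦X⟧} (hf : ∀ n, ‖coeff n f‖ ≤ n) : coeff 0 f = 0 := by
  have := hf 0
  rw [Nat.cast_zero] at this
  exact norm_le_zero_iff.mp this

omit [IsUltrametricDist K] [CompleteSpace K] in
/-- `qEval f 0 = 0`. [cite: SilvermanAEC2009, IV.6.3] -/
theorem qEval_zero {f : ℚ_[p]⟦X⟧} (hf : ∀ n, ‖coeff n f‖ ≤ n) : qEval p K f 0 = 0 := by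
  rw [qEval]
  refine (tsum_congr fun n => ?_).trans tsum_zero
  rcases Nat.eq_zero_or_pos n with rfl | hn
  · rw [coeff_zero_eq_zero hf, map_zero, zero_mul]
  · rw [zero_pow hn.ne', mul_zero]

/-- The partial tail bound: `‖∑_{n ≥ N} φ(fₙ)uⁿ‖ ≤ sup`-form, stated as: every term with `n ≥ N` is
`≤ B` implies the sum of those terms is `≤ B`. We use the concrete consequence
**`‖qEval f u − φ(f₁) u‖ ≤ C·‖u‖²`** for `‖u‖ ≤ ρ`, with `C = sup_n (n+2) ρⁿ`-type constant; we give
the clean version `‖qEval f u − φ(f₁)u‖ ≤ ‖u‖² · B` whenever `n ρ^{n-2} ≤ B` for all `n ≥ 2`.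
[cite: SilvermanAEC2009, IV.6.3] -/
theorem norm_qEval_sub_linear_le {f : ℚ_[p]⟦X⟧} (hf : ∀ n, ‖coeff n f‖ ≤ n) {u : K} (hu : ‖u‖ < 1)
    {ρ B : ℝ} (hρ : ‖u‖ ≤ ρ) (hB0 : 0 ≤ B) (hB : ∀ n : ℕ, 2 ≤ n → (n : ℝ) * ρ ^ (n - 2) ≤ B) :
    ‖qEval p K f u - algebraMap ℚ_[p] K (coeff 1 f) * u‖ ≤ ‖u‖ ^ 2 * B := by
  have hs := summable_qEval hf hu
  -- split off the terms `n = 0, 1`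
  have h2 : qEval p K f u - algebraMap ℚ_[p] K (coeff 1 f) * u =
      ∑' n : ℕ, algebraMap ℚ_[p] K (coeff (n + 2) f) * u ^ (n + 2) := by
    rw [qEval, ← hs.sum_add_tsum_nat_add 2, Finset.sum_range_succ, Finset.sum_range_succ,
      Finset.sum_range_zero, coeff_zero_eq_zero hf, map_zero, zero_mul, zero_add, zero_add, pow_one,
      add_sub_cancel_left]
  rw [h2]
  refine IsUltrametricDist.norm_tsum_le_of_forall_le_of_nonneg (mul_nonneg (sq_nonneg _) hB0) fun n => ?_
  rw [norm_mul, norm_pow, norm_algebraMap_padic, pow_add, mul_comm (‖u‖ ^ n), ← mul_assoc]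
  have hρ0 : 0 ≤ ρ := (norm_nonneg u).trans hρ
  calc ‖coeff (n + 2) f‖ * ‖u‖ ^ 2 * ‖u‖ ^ n ≤ ((n + 2 : ℕ) : ℝ) * ‖u‖ ^ 2 * ρ ^ n := by
        refine mul_le_mul (mul_le_mul_of_nonneg_right (hf _) (sq_nonneg _))
          (pow_le_pow_left₀ (norm_nonneg _) hρ n) (pow_nonneg (norm_nonneg _) _) ?_
        exact mul_nonneg (Nat.cast_nonneg _) (sq_nonneg _)
    _ = ‖u‖ ^ 2 * (((n + 2 : ℕ) : ℝ) * ρ ^ (n + 2 - 2)) := by rw [Nat.add_sub_cancel]; ring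
    _ ≤ ‖u‖ ^ 2 * B := mul_le_mul_of_nonneg_left (hB (n + 2) (by omega)) (sq_nonneg _)

/-! ## §2 Coefficients of `f ∘ G` -/

omit hp in
/-- `coeff m (Gⁿ) = 0` for `m < n` when `G(0) = 0`. [cite: SilvermanAEC2009, IV.6.3] -/
theorem coeff_pow_eq_zero_of_lt {R : Type*} [CommRing R] {G : R⟦X⟧} (hG : constantCoeff G = 0)
    {m n : ℕ} (h : m < n) : coeff m (G ^ n) = 0 := by
  obtain ⟨H, rfl⟩ : X ∣ G := PowerSeries.X_dvd_iff.mpr hG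
  rw [mul_pow, PowerSeries.coeff_X_pow_mul', if_neg (not_le.mpr h)]

omit hp in
/-- **The coefficients of `f ∘ G` as finite sums**: `(f ∘ G)ₘ = ∑_{n ≤ m} fₙ (Gⁿ)ₘ`.
[Bourbaki, Algèbre IV §4 no. 3] [cite: SilvermanAEC2009, IV.6.3] -/
theorem coeff_subst_eq_sum {R : Type*} [CommRing R] {f G : R⟦X⟧} (hG : constantCoeff G = 0) (m : ℕ) :
    coeff m (f.subst G) = ∑ n ∈ Finset.range (m + 1), coeff n f * coeff m (G ^ n) := by
  rw [PowerSeries.coeff_subst' (PowerSeries.HasSubst.of_constantCoeff_zero' hG)]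
  have hsub : (Function.support fun n : ℕ => coeff n f • coeff m (G ^ n)) ⊆ ↑(Finset.range (m + 1)) := by
    intro n hn
    rw [Function.mem_support] at hn
    simp only [Finset.coe_range, Set.mem_Iio]
    by_contra h
    exact hn (by rw [coeff_pow_eq_zero_of_lt hG (by omega), smul_zero])
  rw [finsum_eq_sum_of_support_subset _ hsub]
  simp only [smul_eq_mul]

/-- `‖(ḡⁿ)ₘ‖ ≤ 1` for `g ∈ ℤ_p⟦X⟧`, `ḡ = g ⊗ ℚ_p`. [cite: SilvermanAEC2009, IV.6.3] -/
theorem norm_coeff_map_pow_le_one (g : ℤ_[p]⟦X⟧) (n m : ℕ) :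
    ‖coeff m ((g.map (PadicInt.Coe.ringHom (p := p))) ^ n)‖ ≤ 1 := by
  rw [← map_pow, PowerSeries.coeff_map]
  exact PadicInt.norm_le_one _

/-- **`‖(f ∘ ḡ)ₘ‖ ≤ m`** for `‖fₙ‖ ≤ n` and `g ∈ Xℤ_p⟦X⟧`. [cite: SilvermanAEC2009, IV.6.3] -/
theorem norm_coeff_subst_le {f : ℚ_[p]⟦X⟧} (hf : ∀ n, ‖coeff n f‖ ≤ n) {g : ℤ_[p]⟦X⟧}
    (hg : constantCoeff g = 0) (m : ℕ) :
    ‖coeff m (f.subst (g.map (PadicInt.Coe.ringHom (p := p))))‖ ≤ m := by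
  have hG : constantCoeff (g.map (PadicInt.Coe.ringHom (p := p))) = 0 := by
    rw [← PowerSeries.coeff_zero_eq_constantCoeff, PowerSeries.coeff_map, PowerSeries.coeff_zero_eq_constantCoeff,
      hg, map_zero]
  rw [coeff_subst_eq_sum hG]
  refine IsUltrametricDist.norm_sum_le_of_forall_le_of_nonneg (Nat.cast_nonneg m) fun n hn => ?_
  rw [Finset.mem_range] at hn
  rw [norm_mul]
  calc ‖coeff n f‖ * ‖coeff m ((g.map PadicInt.Coe.ringHom) ^ n)‖ ≤ n * 1 :=
        mul_le_mul (hf n) (norm_coeff_map_pow_le_one g n m) (norm_nonneg _) (Nat.cast_nonneg _)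
    _ ≤ m := by rw [mul_one]; exact_mod_cast Nat.lt_succ_iff.mp hn

/-! ## §3 `qEval (f ∘ ḡ) t = qEval f (g(t))` -/

/-- The truncations `f_N = ∑_{n<N} fₙ Xⁿ` evaluated: `∑_{n<N} φ(fₙ) g(t)ⁿ = ∑ₘ φ((f_N ∘ ḡ)ₘ) tᵐ` where
`(f_N ∘ ḡ)ₘ = ∑_{n<N, n ≤ m} fₙ(ḡⁿ)ₘ` (finite linear combination of the sums `hasSum_ev₁`). [cite: SilvermanAEC2009, IV.6.3] -/
theorem hasSum_truncation {f : ℚ_[p]⟦X⟧} {g : ℤ_[p]⟦X⟧} {t : unitBall K} (ht : ‖(t : K)‖ < 1) (N : ℕ) :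
    HasSum (fun m : ℕ => algebraMap ℚ_[p] K
        (∑ n ∈ Finset.range N, coeff n f * coeff m ((g.map (PadicInt.Coe.ringHom (p := p))) ^ n)) * (t : K) ^ m)
      (∑ n ∈ Finset.range N, algebraMap ℚ_[p] K (coeff n f) *
        ((ev₁ p K t (hasEval_of_norm_lt_one ht) g : unitBall K) : K) ^ n) := by
  have h : ∀ n ∈ Finset.range N, HasSum (fun m : ℕ => algebraMap ℚ_[p] K (coeff n f) *
      (algebraMap ℚ_[p] K ((coeff m (g ^ n) : ℤ_[p]) : ℚ_[p]) * (t : K) ^ m))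
      (algebraMap ℚ_[p] K (coeff n f) * ((ev₁ p K t (hasEval_of_norm_lt_one ht) g : unitBall K) : K) ^ n) := by
    intro n _
    have := (hasSum_ev₁ (hasEval_of_norm_lt_one ht) (g ^ n)).mul_left (algebraMap ℚ_[p] K (coeff n f))
    rwa [map_pow, SubmonoidClass.coe_pow] at this
  have hs := hasSum_sum h
  refine hs.congr_fun fun m => ?_
  rw [map_sum, Finset.sum_mul]
  refine Finset.sum_congr rfl fun n _ => ?_
  rw [map_mul, ← map_pow, PowerSeries.coeff_map, mul_assoc]
  rfl

/-- **Evaluation of `f ∘ ḡ` at `t` is `f` at `g(t)`** (`‖fₙ‖ ≤ n`, `g ∈ Xℤ_p⟦X⟧`, `‖t‖ < 1`):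
`qEval (f ∘ ḡ) t = qEval f (ev₁ g t)`. Proof: truncate `f` below `N`; the truncated identity is
`hasSum_truncation`; both tails are sums of terms of norm `≤ m‖t‖ᵐ` with `m ≥ N`, hence `→ 0`.
[cite: SilvermanAEC2009, IV.6.4] -/
theorem qEval_subst {f : ℚ_[p]⟦X⟧} (hf : ∀ n, ‖coeff n f‖ ≤ n) {g : ℤ_[p]⟦X⟧} (hg : constantCoeff g = 0)
    {t : unitBall K} (ht : ‖(t : K)‖ < 1) :
    qEval p K (f.subst (g.map (PadicInt.Coe.ringHom (p := p)))) (t : K) =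
      qEval p K f ((ev₁ p K t (hasEval_of_norm_lt_one ht) g : unitBall K) : K) := by
  set u : K := ((ev₁ p K t (hasEval_of_norm_lt_one ht) g : unitBall K) : K) with hudef
  have hu : ‖u‖ < 1 := (norm_ev₁_le _ ht.le hg).trans_lt ht
  have hut : ‖u‖ ≤ ‖(t : K)‖ := norm_ev₁_le _ ht.le hg
  set F : ℚ_[p]⟦X⟧ := f.subst (g.map (PadicInt.Coe.ringHom (p := p))) with hFdef
  have hF : ∀ m, ‖coeff m F‖ ≤ m := norm_coeff_subst_le hf hg
  have hsF := summable_qEval (K := K) hF ht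
  have hsf := summable_qEval (K := K) hf hu
  -- it suffices: partial sums of `qEval f u` tend to `qEval F t`
  change qEval p K F (t : K) = ∑' n : ℕ, algebraMap ℚ_[p] K (coeff n f) * u ^ n
  refine (tendsto_nhds_unique hsf.hasSum.tendsto_sum_nat ?_).symm
  rw [Metric.tendsto_atTop]
  intro ε hε
  -- `m ‖t‖^m → 0`: beyond `N₀` all such terms are `< ε`
  have hr0 : 0 ≤ ‖(t : K)‖ := norm_nonneg _
  obtain ⟨N₀, hN₀⟩ : ∃ N₀ : ℕ, ∀ m, N₀ ≤ m → (m : ℝ) * ‖(t : K)‖ ^ m < ε / 2 := by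
    have h := tendsto_self_mul_const_pow_of_lt_one hr0 ht
    rw [Metric.tendsto_atTop] at h
    obtain ⟨N, hN⟩ := h (ε / 2) (half_pos hε)
    refine ⟨N, fun m hm => ?_⟩
    have := hN m hm
    rw [Real.dist_eq, sub_zero, abs_of_nonneg (mul_nonneg (Nat.cast_nonneg _) (pow_nonneg hr0 _))] at this
    exact this
  refine ⟨N₀, fun N hN => ?_⟩
  -- the difference `qEval F t − ∑_{n<N} φ(fₙ)uⁿ` is the sum over `m` of the `N`-tails of the coefficients
  have htr := hasSum_truncation (p := p) (K := K) (f := f) (g := g) ht N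
  have hdiff : qEval p K F (t : K) - ∑ n ∈ Finset.range N, algebraMap ℚ_[p] K (coeff n f) * u ^ n =
      ∑' m : ℕ, algebraMap ℚ_[p] K (coeff m F -
        ∑ n ∈ Finset.range N, coeff n f * coeff m ((g.map (PadicInt.Coe.ringHom (p := p))) ^ n)) *
          (t : K) ^ m := by
    rw [hudef, ← htr.tsum_eq, qEval, ← hsF.tsum_sub htr.summable]
    refine tsum_congr fun m => ?_
    rw [map_sub, sub_mul]
  rw [dist_eq_norm, ← norm_neg, neg_sub, hdiff]
  -- each term: zero for `m < N`, and `≤ m ‖t‖^m < ε/2` for `m ≥ N ≥ N₀`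
  have hG : constantCoeff (g.map (PadicInt.Coe.ringHom (p := p))) = 0 := by
    rw [← PowerSeries.coeff_zero_eq_constantCoeff, PowerSeries.coeff_map, PowerSeries.coeff_zero_eq_constantCoeff,
      hg, map_zero]
  have hterm : ∀ m : ℕ, ‖algebraMap ℚ_[p] K (coeff m F -
      ∑ n ∈ Finset.range N, coeff n f * coeff m ((g.map (PadicInt.Coe.ringHom (p := p))) ^ n)) *
        (t : K) ^ m‖ ≤ ε / 2 := by
    intro m
    by_cases hm : m < N
    · -- all of `(F)ₘ = ∑_{n ≤ m}` is captured by the truncation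
      have : coeff m F - ∑ n ∈ Finset.range N, coeff n f * coeff m ((g.map (PadicInt.Coe.ringHom (p := p))) ^ n)
          = 0 := by
        rw [hFdef, coeff_subst_eq_sum hG, sub_eq_zero]
        refine (Finset.sum_subset (Finset.range_subset_range.mpr (by omega)) fun n hn hn' => ?_)
        rw [Finset.mem_range] at hn hn'
        rw [coeff_pow_eq_zero_of_lt hG (by omega), mul_zero]
      rw [this, map_zero, zero_mul, norm_zero]; exact (half_pos hε).le
    · push Not at hm
      have hb : ‖coeff m F - ∑ n ∈ Finset.range N,
          coeff n f * coeff m ((g.map (PadicInt.Coe.ringHom (p := p))) ^ n)‖ ≤ m := by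
        rw [sub_eq_add_neg]
        refine (IsUltrametricDist.norm_add_le_max _ _).trans (max_le (hF m) ?_)
        rw [norm_neg]
        refine IsUltrametricDist.norm_sum_le_of_forall_le_of_nonneg (Nat.cast_nonneg m) fun n _ => ?_
        by_cases hnm : m < n
        · rw [coeff_pow_eq_zero_of_lt hG hnm, mul_zero, norm_zero]; exact Nat.cast_nonneg m
        · push Not at hnm
          rw [norm_mul]
          calc ‖coeff n f‖ * ‖coeff m ((g.map PadicInt.Coe.ringHom) ^ n)‖ ≤ n * 1 :=
                mul_le_mul (hf n) (norm_coeff_map_pow_le_one g n m) (norm_nonneg _) (Nat.cast_nonneg _)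
            _ ≤ m := by rw [mul_one]; exact_mod_cast hnm
      rw [norm_mul, norm_pow, norm_algebraMap_padic]
      calc _ ≤ (m : ℝ) * ‖(t : K)‖ ^ m := mul_le_mul hb le_rfl (pow_nonneg hr0 _) (Nat.cast_nonneg _)
        _ ≤ ε / 2 := (hN₀ m (hN.trans hm)).le
  calc _ ≤ ε / 2 := IsUltrametricDist.norm_tsum_le_of_forall_le_of_nonneg (half_pos hε).le hterm
    _ < ε := half_lt_self hε

end BallEval

end Literature.NumberTheory.EllipticCurves.Sprung2012.Honda

end Part6

/-!
## Part 7 — port of `Summits/BirchSwinnertonDyer/Rank1Residual/Additive/PadicClosureFormalGroupSeq.lean` (10 declarations kept)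

# `E₁(ℚ̄_p)` in Mathlib's normed field `ℚ̄_p = PadicAlgCl p`: integrality of `ℤ_p`-models,
# completeness of finite-dimensional subfields, points with coordinates in a subfield, and the
# chart estimates for the sequence `z(pᵏ P)`

(Port of the declarations listed in the Part header; the source module's docstring — cell bookkeeping of the BSD
printed-inputs programme — is abridged to its title here.)
-/

section Part7

open scoped _root_.Classical _root_.NNReal _root_.Topology
open _root_.Filter

namespace Literature.NumberTheory.EllipticCurves.Sprung2012.Honda

open Literature.NumberTheory.EllipticCurves Literature.NumberTheory.EllipticCurves.FormalGroupChart
  _root_.WeierstrassCurve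

/-! ## §1 The absolute value of `ℚ̄_p` and completeness of finite-dimensional subfields -/

section Basics

variable {p : ℕ} [hp : Fact p.Prime]

/-- `v(p) = p⁻¹` on `ℚ̄_p`. [cite: SilvermanAEC2009, Prop. VII.2.2] -/
theorem v_natCast_prime : Valued.v (p : PadicAlgCl p) = (p : ℝ≥0)⁻¹ := by
  rw [PadicAlgCl.valuation_p, one_div]

/-- `v(p) < 1`. [cite: SilvermanAEC2009, Prop. VII.2.2] -/
theorem v_prime_lt_one : Valued.v (p : PadicAlgCl p) < 1 := by
  rw [v_natCast_prime]
  exact inv_lt_one_of_one_lt₀ (by exact_mod_cast hp.out.one_lt)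

/-- `v = ‖·‖₊`: `v x ≤ r ↔ ‖x‖ ≤ r`. [cite: SilvermanAEC2009, Prop. VII.2.2] -/
theorem v_le_iff_norm_le (x : PadicAlgCl p) (r : ℝ≥0) : Valued.v x ≤ r ↔ ‖x‖ ≤ (r : ℝ) := by
  rw [PadicAlgCl.valuation_def, ← NNReal.coe_le_coe, coe_nnnorm]

/-- `v = ‖·‖₊`: `v x < r ↔ ‖x‖ < r`. [cite: SilvermanAEC2009, Prop. VII.2.2] -/
theorem v_lt_iff_norm_lt (x : PadicAlgCl p) (r : ℝ≥0) : Valued.v x < r ↔ ‖x‖ < (r : ℝ) := by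
  rw [PadicAlgCl.valuation_def, ← NNReal.coe_lt_coe, coe_nnnorm]

end Basics

/-! ## §2 Points with coordinates in a subfield -/

section SubfieldPoints

variable {F : Type*} [Field F] (V : WeierstrassCurve F) (S : Subfield F)

/-- **The points of `V` with coordinates in a subfield `S ⊇ {a₁, …, a₆}`**: `O` and the affine points
`(x, y)` with `x, y ∈ S` — an additive subgroup, since Mathlib's chord–tangent formulas
(`addX`, `addY`, `slope`, `negY`) are rational functions of the coordinates and the `aᵢ` (Silverman,
*AEC*, III.2.3: "the group law is given by rational functions with coefficients in `K`"; this is the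
group `E(S)` inside `E(F)`). [cite: SilvermanAEC2009, III.2.3] -/
def subfieldPoints (hV : V.a₁ ∈ S ∧ V.a₂ ∈ S ∧ V.a₃ ∈ S ∧ V.a₄ ∈ S ∧ V.a₆ ∈ S) :
    AddSubgroup V.toAffine.Point where
  carrier := {P | ∀ (x y : F) (h : V.toAffine.Nonsingular x y), P = .some x y h → x ∈ S ∧ y ∈ S}
  zero_mem' := fun _ _ _ h => (WeierstrassCurve.Affine.Point.some_ne_zero _ h.symm).elim
  neg_mem' := by
    intro P hP
    rcases P with _ | ⟨x, y, h⟩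
    · intro x y h he
      rw [← WeierstrassCurve.Affine.Point.zero_def, neg_zero] at he
      exact (WeierstrassCurve.Affine.Point.some_ne_zero _ he.symm).elim
    · intro x' y' h' he
      rw [WeierstrassCurve.Affine.Point.neg_some] at he
      have hinj := (WeierstrassCurve.Affine.Point.some.injEq _ _ _ _ _ _).mp he
      obtain ⟨hx, hy⟩ := hP x y h rfl
      refine ⟨hinj.1 ▸ hx, ?_⟩
      rw [← hinj.2, WeierstrassCurve.Affine.negY]
      exact S.sub_mem (S.sub_mem (S.neg_mem hy) (S.mul_mem hV.1 hx)) hV.2.2.1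
  add_mem' := by
    intro P Q hP hQ
    rcases P with _ | ⟨x₁, y₁, h₁⟩
    · intro x y h he
      rw [← WeierstrassCurve.Affine.Point.zero_def, zero_add] at he
      exact hQ x y h he
    rcases Q with _ | ⟨x₂, y₂, h₂⟩
    · intro x y h he
      rw [← WeierstrassCurve.Affine.Point.zero_def, add_zero] at he
      exact hP x y h he
    obtain ⟨hx₁, hy₁⟩ := hP x₁ y₁ h₁ rfl
    obtain ⟨hx₂, hy₂⟩ := hQ x₂ y₂ h₂ rfl
    intro x y h he
    by_cases hxy : x₁ = x₂ ∧ y₁ = V.toAffine.negY x₂ y₂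
    · rw [WeierstrassCurve.Affine.Point.add_of_Y_eq hxy.1 hxy.2] at he
      exact (WeierstrassCurve.Affine.Point.some_ne_zero _ he.symm).elim
    · rw [WeierstrassCurve.Affine.Point.add_some hxy] at he
      obtain ⟨rfl, rfl⟩ : x = V.toAffine.addX x₁ x₂ (V.toAffine.slope x₁ x₂ y₁ y₂) ∧
          y = V.toAffine.addY x₁ x₂ y₁ (V.toAffine.slope x₁ x₂ y₁ y₂) := by
        have := (WeierstrassCurve.Affine.Point.some.injEq _ _ _ _ _ _).mp he
        exact ⟨this.1.symm, this.2.symm⟩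
      -- the slope lies in `S`
      have hL : V.toAffine.slope x₁ x₂ y₁ y₂ ∈ S := by
        by_cases hx : x₁ = x₂
        · have hy : y₁ ≠ V.toAffine.negY x₂ y₂ := fun h => hxy ⟨hx, h⟩
          rw [WeierstrassCurve.Affine.slope_of_Y_ne hx hy]
          refine S.div_mem ?_ ?_
          · exact S.sub_mem (S.add_mem (S.add_mem (S.mul_mem (ofNat_mem S 3) (S.pow_mem hx₁ 2))
              (S.mul_mem (S.mul_mem (ofNat_mem S 2) hV.2.1) hx₁)) hV.2.2.2.1) (S.mul_mem hV.1 hy₁)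
          · rw [WeierstrassCurve.Affine.negY]
            exact S.sub_mem hy₁ (S.sub_mem (S.sub_mem (S.neg_mem hy₁) (S.mul_mem hV.1 hx₁))
              hV.2.2.1)
        · rw [WeierstrassCurve.Affine.slope_of_X_ne hx]
          exact S.div_mem (S.sub_mem hy₁ hy₂) (S.sub_mem hx₁ hx₂)
      have hX : V.toAffine.addX x₁ x₂ (V.toAffine.slope x₁ x₂ y₁ y₂) ∈ S := by
        rw [WeierstrassCurve.Affine.addX]
        exact S.sub_mem (S.sub_mem (S.sub_mem (S.add_mem (S.pow_mem hL 2) (S.mul_mem hV.1 hL))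
          hV.2.1) hx₁) hx₂
      refine ⟨hX, ?_⟩
      rw [WeierstrassCurve.Affine.addY, WeierstrassCurve.Affine.negY, WeierstrassCurve.Affine.negAddY]
      exact S.sub_mem (S.sub_mem (S.neg_mem (S.add_mem (S.mul_mem hL (S.sub_mem hX hx₁)) hy₁))
        (S.mul_mem hV.1 hX)) hV.2.2.1

variable {V S}

/-- Membership in `subfieldPoints`: the affine point `(x, y)` belongs iff `x, y ∈ S`. [cite: SilvermanAEC2009, Prop. VII.2.2] -/
theorem some_mem_subfieldPoints_iff (hV : V.a₁ ∈ S ∧ V.a₂ ∈ S ∧ V.a₃ ∈ S ∧ V.a₄ ∈ S ∧ V.a₆ ∈ S)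
    {x y : F} (h : V.toAffine.Nonsingular x y) :
    (.some x y h : V.toAffine.Point) ∈ subfieldPoints V S hV ↔ x ∈ S ∧ y ∈ S := by
  refine ⟨fun hP => hP x y h rfl, fun hxy => ?_⟩
  intro x' y' h' he
  obtain ⟨rfl, rfl⟩ : x' = x ∧ y' = y := by
    have := (WeierstrassCurve.Affine.Point.some.injEq _ _ _ _ _ _).mp he
    exact ⟨this.1.symm, this.2.symm⟩
  exact hxy

end SubfieldPoints

/-! ## §3 The sequence `z(pᵏ P)` on `E₁` over a valued field -/

section Seq

variable {F : Type*} [Field F] {w : Valuation F ℝ≥0} {V : WeierstrassCurve F}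
  [hV : V.IsIntegral w.integer]

/-- `pᵏ • P ∈ E₁` for `P ∈ E₁`. [cite: SilvermanAEC2009, Prop. VII.2.2] -/
theorem pow_smul_mem_kernel (q k : ℕ) {P : V.toAffine.Point} (hP : P ∈ kernel w V) :
    q ^ k • P ∈ kernel w V :=
  (kernel w V).nsmul_mem hP _

/-- **One step**: `|z(q • Q)| ≤ max(|q|, |z(Q)|) · |z(Q)|` on `E₁` (from `|z(qQ) − q z(Q)| ≤ |z(Q)|²`).
[cite: SilvermanAEC2009, Prop. IV.3.2(a), Prop. VII.2.2] -/
theorem val_zCoord_smul_le (q : ℕ) {Q : V.toAffine.Point} (hQ : Q ∈ kernel w V) :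
    w (q • Q).zCoord ≤ max (w (q : F)) (w Q.zCoord) * w Q.zCoord := by
  obtain ⟨-, -, hest⟩ := val_zCoord_nsmul (w := w) (V := V) q hQ
  have e : (q • Q).zCoord = ((q • Q).zCoord - (q : F) * Q.zCoord) + (q : F) * Q.zCoord := by ring
  rw [e]
  refine (Valuation.map_add w _ _).trans (max_le ?_ ?_)
  · exact hest.trans (by rw [sq]; exact mul_le_mul' (le_max_right _ _) le_rfl)
  · rw [map_mul]; exact mul_le_mul' (le_max_left _ _) le_rfl

/-- **Geometric decay**: with `θ = max(|q|, |z(P)|)`, `|z(qᵏ • P)| ≤ θᵏ · |z(P)|` on `E₁`.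
[cite: SilvermanAEC2009, Prop. VII.2.2] -/
theorem val_zCoord_pow_smul_le (q : ℕ) {P : V.toAffine.Point} (hP : P ∈ kernel w V) (k : ℕ) :
    w (q ^ k • P).zCoord ≤ max (w (q : F)) (w P.zCoord) ^ k * w P.zCoord := by
  induction k with
  | zero => simp
  | succ k ih =>
    have hk : q ^ k • P ∈ kernel w V := pow_smul_mem_kernel (w := w) q k hP
    rw [pow_succ, mul_comm (q ^ k) q, mul_nsmul']
    refine (val_zCoord_smul_le q hk).trans ?_
    have hmono : w (q ^ k • P).zCoord ≤ w P.zCoord :=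
      ih.trans (mul_le_of_le_one_left zero_le (pow_le_one₀ zero_le
        (max_le ((val_natCast_le_one w q)) (val_zCoord_lt_one hP).le)))
    calc max (w (q : F)) (w (q ^ k • P).zCoord) * w (q ^ k • P).zCoord
        ≤ max (w (q : F)) (w P.zCoord) * (max (w (q : F)) (w P.zCoord) ^ k * w P.zCoord) :=
          mul_le_mul' (max_le_max le_rfl hmono) ih
      _ = max (w (q : F)) (w P.zCoord) ^ (k + 1) * w P.zCoord := by ring

/-- **Exact level growth below `|q|`**: if `|z(Q)| < |q|` then `|z(qᵏ • Q)| = |q|ᵏ · |z(Q)|`.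
[cite: SilvermanAEC2009, Prop. IV.3.2(a), Prop. VII.2.2] -/
theorem val_zCoord_pow_smul_eq_of_lt (q : ℕ) {Q : V.toAffine.Point} (hQ : Q ∈ kernel w V)
    (hlt : w Q.zCoord < w (q : F)) (k : ℕ) :
    w (q ^ k • Q).zCoord = w (q : F) ^ k * w Q.zCoord := by
  induction k with
  | zero => simp
  | succ k ih =>
    have hk : q ^ k • Q ∈ kernel w V := pow_smul_mem_kernel (w := w) q k hQ
    have hlt' : w (q ^ k • Q).zCoord < w (q : F) := by
      rw [ih]
      calc w (q : F) ^ k * w Q.zCoord ≤ 1 * w Q.zCoord :=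
            mul_le_mul' (pow_le_one₀ zero_le (val_natCast_le_one w q)) le_rfl
        _ = w Q.zCoord := one_mul _
        _ < w (q : F) := hlt
    rw [pow_succ, mul_comm (q ^ k) q, mul_nsmul', val_zCoord_nsmul_eq_of_lt q hk hlt', ih]
    ring

end Seq

end Literature.NumberTheory.EllipticCurves.Sprung2012.Honda

end Part7

/-!
## Part 8 — port of `Summits/BirchSwinnertonDyer/Rank1Residual/Additive/PadicBallLog.lean` (20 declarations kept)

# The logarithm of `E₁(K)` for `K ⊇ ℚ_p` complete: `Λ(P) = log_E(z(P))`, `Λ(nP) = nΛ(P)`,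
# **additivity**, tangency, and "`Λ(P) = 0 ⇒ P` is `p`-power torsion"

(Port of the declarations listed in the Part header; the source module's docstring — cell bookkeeping of the BSD
printed-inputs programme — is abridged to its title here.)
-/

section Part8

open scoped _root_.Classical _root_.Topology _root_.NNReal
open _root_.Filter _root_.PowerSeries

namespace Literature.NumberTheory.EllipticCurves.Sprung2012.Honda

namespace BallEval

open Literature.NumberTheory.GaloisRepresentations.LubinTate (unitBall mem_unitBall_iff)
open Literature.NumberTheory.EllipticCurves Literature.NumberTheory.EllipticCurves.FormalGroupChart
open _root_.WeierstrassCurve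

variable (p : ℕ) [hp : Fact p.Prime] (K : Type*) [NontriviallyNormedField K] [NormedAlgebra ℚ_[p] K]
  [IsUltrametricDist K] [CompleteSpace K] (M : WeierstrassCurve ℤ_[p])

/-! ## §1 The series `log` at points of the disc -/

/-- **The formal logarithm of the generic fibre `M ⊗ ℚ_p`** (`∈ ℚ_p⟦X⟧`, `logₙ = c_{n−1}/n`).
[cite: SilvermanAEC2009, IV.5] -/
def logQ : ℚ_[p]⟦X⟧ := (M.map (PadicInt.Coe.ringHom (p := p))).formalLog

variable {p M} in
/-- **`‖logₙ‖ ≤ n`** (AEC IV.6.3(a); the tree's `norm_coeff_formalLog_le`). [cite: SilvermanAEC2009, IV.6.3] -/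
theorem norm_coeff_logQ_le (n : ℕ) : ‖coeff n (logQ p M)‖ ≤ n := by
  haveI := M.isIntegral_map_coe
  exact (M.map PadicInt.Coe.ringHom).norm_coeff_formalLog_le n

variable {p M} in
/-- `log₁ = 1`. [cite: SilvermanAEC2009, IV.6.4] -/
theorem coeff_one_logQ : coeff 1 (logQ p M) = 1 := (M.map PadicInt.Coe.ringHom).coeff_one_formalLog

/-- **`bLog t = ∑ₙ logₙ tⁿ ∈ K`**, the logarithm series at `t` (`‖t‖ < 1`). [cite: SilvermanAEC2009, IV.6.4] -/
def bLog (t : K) : K := qEval p K (logQ p M) t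

variable {p K M}

/-- **`log([n](t)) = n · log(t)`** at points: the tree's `formalLog_subst_formalMul` for `M ⊗ ℚ_p`,
evaluated by `qEval_subst`. [cite: SilvermanAEC2009, IV.5] -/
theorem bLog_ev₁_formalMul {t : unitBall K} (ht : ‖(t : K)‖ < 1) (n : ℕ) :
    bLog p K M ((ev₁ p K t (hasEval_of_norm_lt_one ht) (M.formalMul n) : unitBall K) : K) = n * bLog p K M t := by
  haveI := M.isIntegral_map_coe
  have hid : (logQ p M).subst ((M.formalMul n).map (PadicInt.Coe.ringHom (p := p))) = n • logQ p M := by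
    have h := (M.map (PadicInt.Coe.ringHom (p := p))).formalLog_subst_formalMul n
    rw [← M.map_formalMul (PadicInt.Coe.ringHom (p := p)) n] at h
    exact h
  have h := qEval_subst (K := K) (norm_coeff_logQ_le (p := p) (M := M)) (M.constantCoeff_formalMul n) ht
  rw [hid] at h
  rw [bLog, bLog, ← h, qEval, qEval, ← tsum_mul_left]
  refine tsum_congr fun m => ?_
  rw [map_nsmul, nsmul_eq_mul, map_mul, map_natCast, mul_assoc]

/-- **Tangency: `‖log(t) − t‖ ≤ B ‖t‖²`** for `‖t‖ ≤ ρ`, whenever `n ρ^{n−2} ≤ B` for all `n ≥ 2`.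
[cite: SilvermanAEC2009, IV.6.3] -/
theorem norm_bLog_sub_le {t : K} (ht : ‖t‖ < 1) {ρ B : ℝ} (hρ : ‖t‖ ≤ ρ) (hB0 : 0 ≤ B)
    (hB : ∀ n : ℕ, 2 ≤ n → (n : ℝ) * ρ ^ (n - 2) ≤ B) : ‖bLog p K M t - t‖ ≤ ‖t‖ ^ 2 * B := by
  have h := norm_qEval_sub_linear_le (K := K) (norm_coeff_logQ_le (p := p) (M := M)) ht hρ hB0 hB
  rwa [coeff_one_logQ, map_one, one_mul] at h

/-- A usable constant: for `ρ ≤ 1/2`, `n ρ^{n−2} ≤ 2` for all `n ≥ 2`; hence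
**`‖log t − t‖ ≤ 2‖t‖²` for `‖t‖ ≤ 1/2`.** [cite: SilvermanAEC2009, IV.6.4] -/
theorem norm_bLog_sub_le_two {t : K} (ht : ‖t‖ ≤ 1 / 2) : ‖bLog p K M t - t‖ ≤ ‖t‖ ^ 2 * 2 := by
  have ht1 : ‖t‖ < 1 := ht.trans_lt (by norm_num)
  refine norm_bLog_sub_le ht1 ht zero_le_two fun n hn => ?_
  obtain ⟨k, rfl⟩ := Nat.exists_eq_add_of_le hn
  rw [Nat.add_sub_cancel_left, Nat.cast_add, Nat.cast_two]
  -- `(2 + k) (1/2)^k ≤ 2`, i.e. `2 + k ≤ 2^{k+1}`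
  have h2k : (2 + (k : ℝ)) ≤ 2 * 2 ^ k := by
    have : (k : ℝ) + 2 ≤ 2 ^ (k + 1) := by
      have h := Nat.lt_two_pow_self (n := k + 1)
      have h' : (k : ℝ) + 1 + 1 ≤ (2 : ℝ) ^ (k + 1) := by exact_mod_cast h
      linarith
    rw [pow_succ] at this; linarith
  have hpos : (0 : ℝ) < 2 ^ k := pow_pos two_pos k
  calc (2 + (k : ℝ)) * (1 / 2) ^ k = (2 + k) / 2 ^ k := by rw [one_div, inv_pow, div_eq_mul_inv]
    _ ≤ 2 := by rw [div_le_iff₀ hpos]; exact h2k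

/-! ## §2 `Λ(P) = log(z(P))` on `E₁(K)` and `Λ(nP) = nΛ(P)` -/

variable [hE : (M.map PadicInt.Coe.ringHom).IsElliptic]
  [hint : (curveK p K M).IsIntegral (NormedField.valuation (K := K)).integer]

omit hE hint in
/-- `[n+1](t) = F([n](t), t)` at points. [cite: SilvermanAEC2009, IV.2] -/
theorem coe_ev₁_formalMul_succ {t : unitBall K} (ht : ‖(t : K)‖ < 1) (n : ℕ) :
    ((ev₁ p K t (hasEval_of_norm_lt_one ht) (M.formalMul (n + 1)) : unitBall K) : K) =
      (evF p M (ev₁ p K t (hasEval_of_norm_lt_one ht) (M.formalMul n)) t (norm_ev₁_formalMul_lt_one ht n) ht : K) := by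
  have hX' : ‖((ev₁ p K t (hasEval_of_norm_lt_one ht) PowerSeries.X : unitBall K) : K)‖ < 1 := by
    rw [ev₁_X]; exact ht
  rw [M.formalMul_succ, coe_ev₁_substPair ht (M.constantCoeff_formalMul n) PowerSeries.constantCoeff_X
    (norm_ev₁_formalMul_lt_one ht n) hX', ev_apply, evF, ev_apply]
  have e : (![ev₁ p K t (hasEval_of_norm_lt_one ht) (M.formalMul n), t] : Fin 2 → unitBall K) =
      ![ev₁ p K t (hasEval_of_norm_lt_one ht) (M.formalMul n), ev₁ p K t (hasEval_of_norm_lt_one ht) PowerSeries.X] := by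
    funext i; fin_cases i <;> simp [ev₁_X]
  rw [e]

/-- **`z(nP) = [n](z(P))`** for `P ∈ E₁(K)` (induction on `n` with `zCoord_add_eq_evF` and
`[n+1] = F([n], X)`). [cite: SilvermanAEC2009, Prop. VII.2.2] -/
theorem zCoord_nsmul_eq_ev₁_formalMul {P : (curveK p K M).toAffine.Point}
    (hP : P ∈ kernel (NormedField.valuation (K := K)) (curveK p K M)) (n : ℕ) :
    (n • P).zCoord = ((ev₁ p K (zBall P hP) (hasEval_of_norm_lt_one (norm_zBall_lt_one hP)) (M.formalMul n) :
      unitBall K) : K) := by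
  induction n with
  | zero => rw [zero_nsmul, Affine.Point.zCoord_zero, M.formalMul_zero, map_zero, Subring.coe_zero]
  | succ n ih =>
    have hnP : n • P ∈ kernel (NormedField.valuation (K := K)) (curveK p K M) := (kernel (NormedField.valuation (K := K)) (curveK p K M)).nsmul_mem hP n
    rw [succ_nsmul, zCoord_add_eq_evF hnP hP, coe_ev₁_formalMul_succ (norm_zBall_lt_one hP)]
    congr 2
    exact Subtype.ext ih

variable (p K M) in
/-- **`Λ(P) = log(z(P))`**, the logarithm on `E₁(K)`. [cite: Kobayashi2003, §8.4] -/
def ptLog (P : (curveK p K M).toAffine.Point) : K := bLog p K M P.zCoord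

omit [CompleteSpace K] hE hint in
/-- `Λ(O) = 0`. [cite: SilvermanAEC2009, IV.6.4] -/
theorem ptLog_zero : ptLog p K M 0 = 0 := by
  rw [ptLog, Affine.Point.zCoord_zero, bLog, qEval_zero (norm_coeff_logQ_le (p := p) (M := M))]

/-- **`Λ(nP) = n Λ(P)`** on `E₁(K)`. [cite: SilvermanAEC2009, IV.6.4] -/
theorem ptLog_nsmul {P : (curveK p K M).toAffine.Point}
    (hP : P ∈ kernel (NormedField.valuation (K := K)) (curveK p K M)) (n : ℕ) :
    ptLog p K M (n • P) = n * ptLog p K M P := by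
  rw [ptLog, ptLog, zCoord_nsmul_eq_ev₁_formalMul hP n, bLog_ev₁_formalMul (norm_zBall_lt_one hP) n]
  rfl

/-! ## §3 Additivity -/

omit [CompleteSpace K] hE in
/-- `‖z(p^k • P)‖ = ‖p‖^k ‖z(P)‖` at deep level (`‖z P‖ < ‖p‖`; the tree's chart estimate). [cite: SilvermanAEC2009, IV.6.4] -/
theorem norm_zCoord_pow_smul_eq {P : (curveK p K M).toAffine.Point}
    (hP : P ∈ kernel (NormedField.valuation (K := K)) (curveK p K M)) (hlt : ‖P.zCoord‖ < ‖(p : K)‖) (k : ℕ) :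
    ‖(p ^ k • P).zCoord‖ = ‖(p : K)‖ ^ k * ‖P.zCoord‖ := by
  have h := val_zCoord_pow_smul_eq_of_lt (w := NormedField.valuation (K := K)) p hP
    (by simpa [← NNReal.coe_lt_coe, NormedField.valuation_apply] using hlt) k
  have h' := congrArg (fun x : ℝ≥0 => (x : ℝ)) h
  simpa [NormedField.valuation_apply] using h'

omit [CompleteSpace K] hE in
/-- `‖z(p^k • P)‖ ≤ ‖z(P)‖` and `→ 0`: precisely `‖z(p^k P)‖ ≤ max(‖p‖, ‖zP‖)^k ‖zP‖`. [cite: SilvermanAEC2009, IV.6.4] -/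
theorem norm_zCoord_pow_smul_le {P : (curveK p K M).toAffine.Point}
    (hP : P ∈ kernel (NormedField.valuation (K := K)) (curveK p K M)) (k : ℕ) :
    ‖(p ^ k • P).zCoord‖ ≤ max ‖(p : K)‖ ‖P.zCoord‖ ^ k * ‖P.zCoord‖ := by
  have h := val_zCoord_pow_smul_le (w := NormedField.valuation (K := K)) p hP k
  have h' : ((NormedField.valuation (K := K) (p ^ k • P).zCoord : ℝ≥0) : ℝ) ≤
      ((max (NormedField.valuation (K := K) (p : K)) (NormedField.valuation (K := K) P.zCoord) ^ k *
        NormedField.valuation (K := K) P.zCoord : ℝ≥0) : ℝ) := by exact_mod_cast h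
  simpa [NormedField.valuation_apply, NNReal.coe_max] using h'

omit [IsUltrametricDist K] [CompleteSpace K] hE hint in
/-- `0 < ‖p‖ < 1` in `K`. [cite: SilvermanAEC2009, IV.6.4] -/
theorem norm_p_pos_lt : 0 < ‖(p : K)‖ ∧ ‖(p : K)‖ < 1 := by
  have h : (p : K) = algebraMap ℚ_[p] K (p : ℚ_[p]) := by rw [map_natCast]
  rw [h, norm_algebraMap_padic, Padic.norm_p]
  have h1 : (1 : ℝ) < p := by exact_mod_cast hp.out.one_lt
  exact ⟨inv_pos.mpr (by linarith), inv_lt_one_of_one_lt₀ h1⟩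

/-- The additivity defect `h(P, Q) = Λ(P+Q) − Λ(P) − Λ(Q)` scales: `h(p^k P, p^k Q) = p^k h(P, Q)`. [cite: SilvermanAEC2009, IV.6.4] -/
theorem ptLog_defect_smul {P Q : (curveK p K M).toAffine.Point}
    (hP : P ∈ kernel (NormedField.valuation (K := K)) (curveK p K M))
    (hQ : Q ∈ kernel (NormedField.valuation (K := K)) (curveK p K M)) (k : ℕ) :
    ptLog p K M (p ^ k • P + p ^ k • Q) - ptLog p K M (p ^ k • P) - ptLog p K M (p ^ k • Q) =
      (p : K) ^ k * (ptLog p K M (P + Q) - ptLog p K M P - ptLog p K M Q) := by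
  rw [← smul_add, ptLog_nsmul ((kernel (NormedField.valuation (K := K)) (curveK p K M)).add_mem hP hQ), ptLog_nsmul hP, ptLog_nsmul hQ]
  push_cast
  ring

omit hE in
/-- The defect is quadratically small at deep level: if `‖zP‖, ‖zQ‖ ≤ r ≤ 1/2` then
`‖Λ(P+Q) − Λ(P) − Λ(Q)‖ ≤ 2 r²`. [cite: SilvermanAEC2009, IV.6.3] -/
theorem norm_ptLog_defect_le {P Q : (curveK p K M).toAffine.Point}
    (hP : P ∈ kernel (NormedField.valuation (K := K)) (curveK p K M))
    (hQ : Q ∈ kernel (NormedField.valuation (K := K)) (curveK p K M)) {r : ℝ}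
    (hPr : ‖P.zCoord‖ ≤ r) (hQr : ‖Q.zCoord‖ ≤ r) (hr : r ≤ 1 / 2) :
    ‖ptLog p K M (P + Q) - ptLog p K M P - ptLog p K M Q‖ ≤ r ^ 2 * 2 := by
  have hr0 : 0 ≤ r := (norm_nonneg _).trans hPr
  -- `‖z(P+Q)‖ ≤ r` and `‖z(P+Q) − zP − zQ‖ ≤ r²`
  have hPQ : ‖(P + Q).zCoord‖ ≤ r := by
    have h := val_zCoord_add_le (w := NormedField.valuation (K := K)) hP hQ
    have h' : ((NormedField.valuation (K := K) (P + Q).zCoord : ℝ≥0) : ℝ) ≤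
        ((max (NormedField.valuation (K := K) P.zCoord) (NormedField.valuation (K := K) Q.zCoord) : ℝ≥0) : ℝ) := by
      exact_mod_cast h
    simp only [NormedField.valuation_apply, NNReal.coe_max, coe_nnnorm] at h'
    exact h'.trans (max_le hPr hQr)
  have hsub : ‖(P + Q).zCoord - P.zCoord - Q.zCoord‖ ≤ r ^ 2 := by
    have h := val_zCoord_add_sub_le (w := NormedField.valuation (K := K)) hP hQ
    have h' : ((NormedField.valuation (K := K) ((P + Q).zCoord - P.zCoord - Q.zCoord) : ℝ≥0) : ℝ) ≤
        ((max (NormedField.valuation (K := K) P.zCoord) (NormedField.valuation (K := K) Q.zCoord) ^ 2 : ℝ≥0) : ℝ) := by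
      exact_mod_cast h
    simp only [NormedField.valuation_apply, NNReal.coe_pow, NNReal.coe_max, coe_nnnorm] at h'
    exact h'.trans (pow_le_pow_left₀ (le_max_of_le_left (norm_nonneg _)) (max_le hPr hQr) 2)
  have e : ptLog p K M (P + Q) - ptLog p K M P - ptLog p K M Q =
      (bLog p K M (P + Q).zCoord - (P + Q).zCoord) - (bLog p K M P.zCoord - P.zCoord) -
        (bLog p K M Q.zCoord - Q.zCoord) + ((P + Q).zCoord - P.zCoord - Q.zCoord) := by
    simp only [ptLog]; ring
  rw [e]
  have b1 := norm_bLog_sub_le_two (p := p) (K := K) (M := M) (hPQ.trans hr)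
  have b2 := norm_bLog_sub_le_two (p := p) (K := K) (M := M) (hPr.trans hr)
  have b3 := norm_bLog_sub_le_two (p := p) (K := K) (M := M) (hQr.trans hr)
  have hb : ∀ {x : K}, ‖x‖ ≤ r → ‖x‖ ^ 2 * 2 ≤ r ^ 2 * 2 := fun hx =>
    mul_le_mul_of_nonneg_right (pow_le_pow_left₀ (norm_nonneg _) hx 2) zero_le_two
  have hr2 : r ^ 2 ≤ r ^ 2 * 2 := le_mul_of_one_le_right (sq_nonneg r) one_le_two
  refine (IsUltrametricDist.norm_add_le_max _ _).trans (max_le ?_ (hsub.trans hr2))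
  rw [sub_eq_add_neg, sub_eq_add_neg]
  refine (IsUltrametricDist.norm_add_le_max _ _).trans (max_le ?_ ?_)
  · refine (IsUltrametricDist.norm_add_le_max _ _).trans (max_le (b1.trans (hb hPQ)) ?_)
    rw [norm_neg]; exact b2.trans (hb hPr)
  · rw [norm_neg]; exact b3.trans (hb hQr)

/-- **Additivity of the logarithm on `E₁(K)`: `Λ(P + Q) = Λ(P) + Λ(Q)`** (`K ⊇ ℚ_p` complete
ultrametric): the defect `h` satisfies `h(P,Q) = h(p^kP, p^kQ)/p^k` and, at deep level,
`‖h(p^kP, p^kQ)‖ ≤ 2 (‖p‖^k c)²`, so `‖h(P,Q)‖ ≤ 2c²‖p‖^k → 0`. [cite: SilvermanAEC2009, IV.6.4] -/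
theorem ptLog_add {P Q : (curveK p K M).toAffine.Point}
    (hP : P ∈ kernel (NormedField.valuation (K := K)) (curveK p K M))
    (hQ : Q ∈ kernel (NormedField.valuation (K := K)) (curveK p K M)) :
    ptLog p K M (P + Q) = ptLog p K M P + ptLog p K M Q := by
  obtain ⟨hp0, hp1⟩ := norm_p_pos_lt (p := p) (K := K)
  -- Step 1: push both points to deep level `‖z‖ < ‖p‖/2 ≤ …` by a power of `p`.
  set r₀ := max ‖(p : K)‖ (max ‖P.zCoord‖ ‖Q.zCoord‖) with hr₀
  have hr₀1 : r₀ < 1 := max_lt hp1 (max_lt (norm_zCoord_lt_one hP) (norm_zCoord_lt_one hQ))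
  have hr₀0 : 0 ≤ r₀ := le_max_of_le_left (norm_nonneg _)
  set c := ‖(p : K)‖ / 2 with hc
  have hc0 : 0 < c := half_pos hp0
  obtain ⟨j, hj⟩ : ∃ j : ℕ, r₀ ^ j < c := exists_pow_lt_of_lt_one hc0 hr₀1
  have hdeep : ∀ {R : (curveK p K M).toAffine.Point},
      R ∈ kernel (NormedField.valuation (K := K)) (curveK p K M) → ‖R.zCoord‖ ≤ max ‖P.zCoord‖ ‖Q.zCoord‖ →
      ‖(p ^ j • R).zCoord‖ < c := by
    intro R hR hRle
    refine (norm_zCoord_pow_smul_le hR j).trans_lt ?_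
    have hR1 : ‖R.zCoord‖ ≤ 1 := (norm_zCoord_lt_one hR).le
    have hm : max ‖(p : K)‖ ‖R.zCoord‖ ≤ r₀ := max_le (le_max_left _ _) (hRle.trans (le_max_right _ _))
    calc max ‖(p : K)‖ ‖R.zCoord‖ ^ j * ‖R.zCoord‖ ≤ r₀ ^ j * 1 :=
          mul_le_mul (pow_le_pow_left₀ (le_max_of_le_left (norm_nonneg _)) hm j) hR1 (norm_nonneg _)
            (pow_nonneg hr₀0 _)
      _ < c := by rw [mul_one]; exact hj
  set P' := p ^ j • P with hP'
  set Q' := p ^ j • Q with hQ'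
  have hP'm : P' ∈ kernel (NormedField.valuation (K := K)) (curveK p K M) := (kernel (NormedField.valuation (K := K)) (curveK p K M)).nsmul_mem hP _
  have hQ'm : Q' ∈ kernel (NormedField.valuation (K := K)) (curveK p K M) := (kernel (NormedField.valuation (K := K)) (curveK p K M)).nsmul_mem hQ _
  have hP'c : ‖P'.zCoord‖ < c := hdeep hP (le_max_left _ _)
  have hQ'c : ‖Q'.zCoord‖ < c := hdeep hQ (le_max_right _ _)
  -- Step 2: the defect of `(P', Q')` vanishes.
  have hdef' : ptLog p K M (P' + Q') - ptLog p K M P' - ptLog p K M Q' = 0 := by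
    set d := ptLog p K M (P' + Q') - ptLog p K M P' - ptLog p K M Q' with hd
    by_contra hne
    have hdpos : 0 < ‖d‖ := norm_pos_iff.mpr hne
    -- for every k: ‖p‖^k ‖d‖ ≤ 2 (‖p‖^k c)²  ⇒  ‖d‖ ≤ 2 c² ‖p‖^k
    have hk : ∀ k : ℕ, ‖d‖ ≤ 2 * c ^ 2 * ‖(p : K)‖ ^ k := by
      intro k
      have hpk : 0 < ‖(p : K)‖ ^ k := pow_pos hp0 k
      have e := ptLog_defect_smul hP'm hQ'm k
      have hPk : ‖(p ^ k • P').zCoord‖ ≤ ‖(p : K)‖ ^ k * c := by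
        rw [norm_zCoord_pow_smul_eq hP'm (hP'c.trans_le (by rw [hc]; linarith))]
        exact mul_le_mul_of_nonneg_left hP'c.le hpk.le
      have hQk : ‖(p ^ k • Q').zCoord‖ ≤ ‖(p : K)‖ ^ k * c := by
        rw [norm_zCoord_pow_smul_eq hQ'm (hQ'c.trans_le (by rw [hc]; linarith))]
        exact mul_le_mul_of_nonneg_left hQ'c.le hpk.le
      have hrk : ‖(p : K)‖ ^ k * c ≤ 1 / 2 := by
        have : ‖(p : K)‖ ^ k ≤ 1 := pow_le_one₀ hp0.le hp1.le
        calc ‖(p : K)‖ ^ k * c ≤ 1 * c := mul_le_mul_of_nonneg_right this hc0.le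
          _ ≤ 1 / 2 := by rw [one_mul, hc]; linarith
      have hb := norm_ptLog_defect_le ((kernel (NormedField.valuation (K := K)) (curveK p K M)).nsmul_mem hP'm _) ((kernel (NormedField.valuation (K := K)) (curveK p K M)).nsmul_mem hQ'm _) hPk hQk hrk
      rw [e, norm_mul, norm_pow] at hb
      refine le_of_mul_le_mul_left ?_ hpk
      calc ‖(p : K)‖ ^ k * ‖d‖ ≤ (‖(p : K)‖ ^ k * c) ^ 2 * 2 := hb
        _ = ‖(p : K)‖ ^ k * (2 * c ^ 2 * ‖(p : K)‖ ^ k) := by ring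
    obtain ⟨k, hk'⟩ : ∃ k : ℕ, ‖(p : K)‖ ^ k < ‖d‖ / (2 * c ^ 2) :=
      exists_pow_lt_of_lt_one (div_pos hdpos (by positivity)) hp1
    have := hk k
    rw [lt_div_iff₀ (by positivity)] at hk'
    linarith
  -- Step 3: descend.
  have e := ptLog_defect_smul hP hQ j
  rw [← hP', ← hQ', hdef'] at e
  have hpj : (p : K) ^ j ≠ 0 := pow_ne_zero j (norm_pos_iff.mp hp0)
  have := (mul_eq_zero.mp e.symm).resolve_left hpj
  linear_combination this

/-! ## §4 `Λ(P) = 0` only on `p`-power torsion -/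

omit hE hint in
/-- At deep level the logarithm is an isometry: `‖Λ(P)‖ = ‖z(P)‖` for `‖zP‖ < 1/2`. [cite: SilvermanAEC2009, IV.6.4] -/
theorem norm_ptLog_eq {P : (curveK p K M).toAffine.Point} (hlt : ‖P.zCoord‖ < 1 / 2) :
    ‖ptLog p K M P‖ = ‖P.zCoord‖ := by
  by_cases h0 : P.zCoord = 0
  · rw [ptLog, h0, bLog, qEval_zero (norm_coeff_logQ_le (p := p) (M := M)), norm_zero]
  have hb := norm_bLog_sub_le_two (p := p) (K := K) (M := M) hlt.le
  have hpos : 0 < ‖P.zCoord‖ := norm_pos_iff.mpr h0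
  have hlt' : ‖bLog p K M P.zCoord - P.zCoord‖ < ‖P.zCoord‖ := by
    refine hb.trans_lt ?_
    calc ‖P.zCoord‖ ^ 2 * 2 = ‖P.zCoord‖ * (‖P.zCoord‖ * 2) := by ring
      _ < ‖P.zCoord‖ * 1 := by
          refine mul_lt_mul_of_pos_left ?_ hpos
          linarith
      _ = ‖P.zCoord‖ := mul_one _
  rw [ptLog]
  have e : bLog p K M P.zCoord = (bLog p K M P.zCoord - P.zCoord) + P.zCoord := by ring
  rw [e, IsUltrametricDist.norm_add_eq_max_of_norm_ne_norm (ne_of_lt hlt'), max_eq_right hlt'.le]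

/-- **`Λ(P) = 0 ⇒ p^k • P = 0` for some `k`.** [cite: SilvermanAEC2009, IV.6.4] -/
theorem exists_pow_smul_eq_zero_of_ptLog_eq_zero {P : (curveK p K M).toAffine.Point}
    (hP : P ∈ kernel (NormedField.valuation (K := K)) (curveK p K M)) (h0 : ptLog p K M P = 0) :
    ∃ k : ℕ, p ^ k • P = 0 := by
  obtain ⟨hp0, hp1⟩ := norm_p_pos_lt (p := p) (K := K)
  set r₀ := max ‖(p : K)‖ ‖P.zCoord‖ with hr₀
  have hr₀1 : r₀ < 1 := max_lt hp1 (norm_zCoord_lt_one hP)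
  obtain ⟨k, hk⟩ : ∃ k : ℕ, r₀ ^ k < 1 / 2 := exists_pow_lt_of_lt_one (by norm_num) hr₀1
  refine ⟨k, ?_⟩
  have hPk : p ^ k • P ∈ kernel (NormedField.valuation (K := K)) (curveK p K M) := (kernel (NormedField.valuation (K := K)) (curveK p K M)).nsmul_mem hP _
  have hlt : ‖(p ^ k • P).zCoord‖ < 1 / 2 := by
    refine (norm_zCoord_pow_smul_le hP k).trans_lt ?_
    calc max ‖(p : K)‖ ‖P.zCoord‖ ^ k * ‖P.zCoord‖ ≤ r₀ ^ k * 1 :=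
          mul_le_mul le_rfl (norm_zCoord_lt_one hP).le (norm_nonneg _) (pow_nonneg (le_max_of_le_left (norm_nonneg _)) _)
      _ < 1 / 2 := by rw [mul_one]; exact hk
  have hL : ptLog p K M (p ^ k • P) = 0 := by rw [ptLog_nsmul hP, h0, mul_zero]
  have hz : ‖(p ^ k • P).zCoord‖ = 0 := by rw [← norm_ptLog_eq hlt, hL, norm_zero]
  exact (zCoord_eq_zero_iff hPk).mp (norm_eq_zero.mp hz)

end BallEval

end Literature.NumberTheory.EllipticCurves.Sprung2012.Honda

end Part8

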